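import Literature.Analysis.FluidPDE.PineauVicolPressure
import HarnessLib

/-!
# Pineau–Vicol 2026, §8: Lemma 8.2 (8.5) and Proposition 8.3 (8.6) — the large-`|α|` estimate for
# RDSS profiles on each time slice, via Lemma 6.4 / Proposition 6.5 for a general source

Analysis/FluidPDE proofs file (theorems only; **no definitions, no named facts**), sequel of
`PineauVicolPressure.lean` (Lemma 6.3 (6.11), Proposition 6.5 (6.20)).
B. Pineau, V. Vicol, *On rotated backwards self-similar solutions of the incompressible 3D
Navier–Stokes equations*, arXiv:2607.09619v2 (2026), §8 "DSS and RDSS: proof of the main result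
for `α` large and `λ` close to `1`", Lemma 8.1 (8.2)–(8.3), Lemma 8.2 (8.4)–(8.5), Proposition 8.3
(8.6) (pp. 27–28); §6.4, Lemma 6.4 (6.17)–(6.19) and Proposition 6.5 (pp. 21–22).

## The source, as printed (pp. 27–28)

With `S = 2 log λ` the period of the RDSS profile `U(y, s)` and (1.14a) the profile equation
`∂_sU + α(JU − (Jy·∇)U) + ½U + ½(y·∇)U − ΔU + (U·∇)U + ∇P = 0`:
**Lemma 8.1.** "… the profile `U(·, s)` satisfies the pointwise bound (1.9) for all `s ∈ [0, S]` …
The space-gradients of `U` satisfy (2.1) and the pressure `P(·, s)` obeys estimate (2.2) for every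
`s ∈ [0, S]` … Moreover, there exists an `(α, S)`-independent constant `C_{U,s} = C_{U,s}(C_{U,0}) > 0`
such that `|∂_sU(y, s)| ≤ C_{U,s}S(1 + |α|)²(1 + |y|)⁻¹`, `|∇∂_sU(y, s)| ≤ C_{U,s}S(1 + |α|)²(1 + |y|²)⁻¹`
(8.2) for all `(y, s) ∈ ℝ³ × [0, S]`." (8.3): `|∇ᵏ_yU(y,s)| ≤ C_{U,k}(1+|y|)^{−k−1}`,
`|∇ᵏ_yP(y,s)| ≤ C_{P,k}(1+|y|)^{−2+σ−k}`.
**Lemma 8.2.** "Let `u` satisfy the conditions of Theorem 1.7 with parameters `α, ᾱ, λ,` and `λ̄`.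
Assume that the smooth incompressible vector field `U : ℝ³ × [0, S] → ℝ³` satisfies the bounds
(8.3). Define `𝓝 := −(U·∇)U − ∇P − ∂_sU` (8.4), where `P = RᵢRⱼ(UᵢUⱼ)` (as in the proof of
Lemma 2.1). For any `ε ∈ (0,1]`, there exist constants `C_ε = C_ε(ε, C_{U,0}) > 0` and
`δ_ε = δ(ε, C_{U,0}) > 0` such that `‖(𝓝)_a‖_{L²_μ} ≤ ε + C_ε‖(U)_a‖_{L²_μ} + C_ε‖∇(U)_a‖_{L²_μ}`
(8.5), holds uniformly for all `s ∈ [0, S]`, provided that `S(1 + |α|)² ≤ δ_ε`."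
*Proof.* "The estimate for `−(U·∇U) − ∇P` is identical to that in Lemma 6.3, except that we take
smallness factor `ε/2` instead of `ε`. To deal with the remaining term `∂_sU`, we simply apply
Lemma 8.1 to obtain (say), `‖(∂_sU)_a‖_{L²_μ} ≤ ‖∂_sU‖_{L²_μ} ≤ C_{U,s}S(1 + |α|)²‖(1 + |y|)⁻¹‖_{L²_μ} ≤ ε/2`."
"By arguing exactly as in the proof of Proposition 6.5, we obtain smallness of `α𝓡U` in `L²_μ`,
**Proposition 8.3.** Let `u` satisfy the conditions of Theorem 1.7 with parameters `α, ᾱ, λ` and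
`λ̄`. Suppose that the profiles `(U, P)` satisfy the bounds (8.3). For any `ε ∈ (0,1]`, there exist
constants `A_ε = A(ε, C_{U,0}) ≥ 1` and `δ_ε = δ(ε, C_{U,0})`, such that for all `|α| ≥ A_ε`, if
`S(1 + |α|)² ≤ δ_ε` we have `|α| ‖𝓡U‖_{L²_μ} ≤ ε` (8.6), uniformly for all `s ∈ [0, S]`."

## Rendering

Everything is stated **on one time slice**: `U = U(·, s)`, `P = P(·, s)` and the slice derivative
`F = ∂_sU(·, s)` are fields on `ℝ³`; the profile equation (1.14a) on the slice reads
`α𝓡U + ½U + ½DU[y] − ΔU + (U·∇)U + ∇P + F = 0` and (8.4) is `𝓝 = −(U·∇)U − ∇P − F`. The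
uniformity "for all `s ∈ [0, S]`" is then the statement applied at each `s` with the
`s`-independent constants.

* "arguing exactly as in the proof of Proposition 6.5": **Lemma 6.4 and the Proposition 6.5
  algebra for a general continuous source** `𝓢` of polynomial growth with
  `α𝓡U + ½U + ½DU[y] − ΔU = 𝓢` — `abs_mul_integral_gaussWeight_mul_norm_rotOp_sq_le_of_source`
  ((6.18): `|α|‖𝓡U‖² ≤ ‖𝓡U‖ ‖(𝓢)_a‖`, from the companion files' `⟨𝓡U, U⟩_γ = 0`,
  `⟨(−Δ + ½y·∇)U, 𝓡U⟩_γ = 0` and Lemma 6.2 (ii)), `half_norm_sq_add_le_of_source` ((6.19)),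
  `pineauVicol_lemma_6_4_of_source` ((6.17)), `pineauVicol_prop_6_5_of_source` ((6.20) from a
  bound of the form (6.11)/(8.5) on `‖(𝓢)_a‖`).
* **(8.5)** `pineauVicol_8_5` (explicit: the (6.11) constant of `PineauVicolPressure.lean` plus the
  slice term `C_{U,s}S(1+|α|)²‖1‖_{L²_μ}`, using "`‖(∂_sU)_a‖_{L²_μ} ≤ ‖∂_sU‖_{L²_μ}`") and
  **Lemma 8.2 as printed** `pineauVicol_lemma_8_2` (`∃ C_ε > 0, ∃ δ_ε > 0`, before `U`).
* **(8.6)** `pineauVicol_8_6` (explicit threshold) and **Proposition 8.3 as printed**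
  `pineauVicol_prop_8_3` (`∃ A_ε ≥ 1, ∃ δ_ε > 0`, before `U`).
* **(8.6) with hypotheses on the profile slice only**: the polynomial growth of `∇P` assumed in
  `pineauVicol_8_6` / `pineauVicol_prop_8_3` is read off the slice equation (1.14a)
  (`norm_gradient_le_of_slice_equation`:
  `|∇P(y)| ≤ (|α|(C₀ + C₁) + C₀ + C₁ + 3C₂ + C₀C₁ + sup|∂_sU|)(1 + |y|)`), whence
  `pineauVicol_8_6'` / `pineauVicol_prop_8_3'`.
* **Lemma 8.1, two proof steps as printed** (towards (8.2) itself, which is NOT yet a tree theorem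
  on the RDSS class): `norm_sliceDeriv_le_of_slice_equation` — the first display of the proof with
  `k = 0`, on a slice: `|∂_sU(y)| ≤ (1+|α|)(C₀ + 2C₁ + 6C₂ + C₀C₁ + C_P)(1+|y|)⁻¹` read off (1.14a)
  from (8.3) for `U` (`k ≤ 2`) and `|∇P| ≤ C_P(1+|y|)⁻¹`, and `norm_fderiv_sliceDeriv_le_of_slice_equation`
  — the same display with `k = 1`: `‖D∂_sU(y)‖ ≤ (1+|α|)(4C₁ + 3C₂ + C₃ + 2C₁² + 2C₀C₂ + C_{P,2})(1+|y|)⁻²`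
  read off the `y`-derivative of (1.14a), given in addition `‖D(ΔU)‖ ≤ C₃(1+|y|)⁻²` and
  `‖D∇P‖ ≤ C_{P,2}(1+|y|)⁻²`; `norm_deriv_le_of_periodic` — the closing
  "Poincaré's inequality in `s`" step as the elementary statement it uses: an `S`-periodic curve
  `f` in a Banach space with `‖f''‖ ≤ M` has `‖f'‖ ≤ MS/2` (zero mean of `f'` over a period).
  The THIRD display ("by applying `∂ₛ` to (1.14a) … `|∂²_sU| ≤ C_{U,s}(1+|α|)²(1+|y|)⁻¹`,
  `|∇∂²_sU| ≤ C_{U,s}(1+|α|)²(1+|y|)⁻²`") as the algebra it is, on a slice, for the LINEAR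
  `s`-differentiated equation `∂ₛV + α𝓡V + ½V + ½(y·∇)V − ΔV + (V·∇)U + (U·∇)V + ∇P′ = 0`
  (`V = ∂ₛU`, `P′ = ∂ₛP`, `W = ∂ₛV`): `norm_sliceDeriv2_le_of_dslice_equation`
  (`|W| ≤ (1+|α|)(D₀ + 2D₁ + 6D₂ + C₁D₀ + C₀D₁ + D_P)(1+|y|)⁻¹`) and
  `norm_fderiv_sliceDeriv2_le_of_dslice_equation`
  (`‖DW‖ ≤ (1+|α|)(4D₁ + 3D₂ + D₃ + 4C₁D₁ + 2C₂D₀ + 2C₀D₂ + D_P)(1+|y|)⁻²`), the constants `Dₖ` of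
  `V` and `D_P` of `∇P′` being those of the first two displays (of size `C_{U,s}(1+|α|)`).
  Still missing for (8.2): the first display for `k = 2, 3`, (8.3) for `P` with `k ≥ 2`, the second
  display (`|∇ᵏ∂_sP|` via a bilinear pressure potential, "arguing as in Lemma 2.1"), and the
  identification of `V, W, P′` with the `s`-derivatives of a jointly smooth periodic profile.

Hypotheses, as in `PineauVicolPressure.lean`: `U, P ∈ C²`; (1.9), (2.1) (= (8.3), `k ≤ 2`), (2.2)
for one exponent `s' = 2 − σ > 3/2`; the Poisson equation `ΔP = −∇·((U·∇)U)` of the Riesz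
pressure; `∇P` of polynomial growth (assumed in `pineauVicol_prop_8_3`, derived in
`pineauVicol_prop_8_3'`); the slice derivative `F` continuous with the first bound of
(8.2); the period `S ≥ 0`. Constants depend on `(ε, C_{U,0}, C_{U,1}, C_{U,s})` explicitly (the
printed dependence on `C_{U,0}` alone is Lemma 2.1 / Lemma 8.1, not in the tree); `‖1‖_{L²_μ}`
enters as `(∫ γ)^{1/2}`.

## References

* B. Pineau, V. Vicol, arXiv:2607.09619v2 (2026): §8, Lemma 8.1 (8.2)–(8.3), Lemma 8.2
  (8.4)–(8.5), Proposition 8.3 (8.6) (pp. 27–28); (1.14a) (p. 7); §6.4, (6.17)–(6.20)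
  (pp. 21–22). [PineauVicol2026]
-/

noncomputable section

open Set MeasureTheory Filter Real Function Metric
open scoped RealInnerProductSpace ContDiff Topology Laplacian

namespace Literature.Analysis.FluidPDE

namespace PineauVicol2026

/-! ### Tools -/

/-- A growth bound has a nonnegative constant. [folklore] -/
private theorem nonneg_of_norm_le' {F' : Type*} [NormedAddCommGroup F']
    {f : EuclideanSpace ℝ (Fin 3) → F'} {C : ℝ} {N : ℕ}
    (h : ∀ y, ‖f y‖ ≤ C * (1 + ‖y‖) ^ N) : 0 ≤ C := by
  have := (norm_nonneg (f 0)).trans (h 0)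
  simpa using this

/-- `J` is continuous. [folklore] -/
private theorem continuous_rotGen'' : Continuous (rotGen : EuclideanSpace ℝ (Fin 3) → EuclideanSpace ℝ (Fin 3)) := by
  have h : (rotGen : EuclideanSpace ℝ (Fin 3) → EuclideanSpace ℝ (Fin 3)) = fun x => rotGenL x :=
    funext fun x => (rotGenL_apply x).symm
  rw [h]; exact rotGenL.continuous

/-- `𝓡V` is continuous for `V ∈ C¹`. [folklore] -/
private theorem continuous_rotOp' {V : EuclideanSpace ℝ (Fin 3) → EuclideanSpace ℝ (Fin 3)}
    (hV : ContDiff ℝ 1 V) : Continuous fun x => rotGen (V x) - fderiv ℝ V x (rotGen x) :=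
  (continuous_rotGen''.comp hV.continuous).sub
    ((hV.continuous_fderiv one_ne_zero).clm_apply continuous_rotGen'')

/-- Growth of `𝓡V`: `|𝓡V(y)| ≤ 2C(1+|y|)^{N+1}`. [folklore] -/
private theorem norm_rotOp_le'' {U : EuclideanSpace ℝ (Fin 3) → EuclideanSpace ℝ (Fin 3)}
    {C : ℝ} {N : ℕ} (hU0 : ∀ y, ‖U y‖ ≤ C * (1 + ‖y‖) ^ N)
    (hU1 : ∀ y, ‖fderiv ℝ U y‖ ≤ C * (1 + ‖y‖) ^ N) (y : EuclideanSpace ℝ (Fin 3)) :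
    ‖rotGen (U y) - fderiv ℝ U y (rotGen y)‖ ≤ 2 * C * (1 + ‖y‖) ^ (N + 1) := by
  have hC : 0 ≤ C := nonneg_of_norm_le' hU0
  have hone : (1 : ℝ) ≤ 1 + ‖y‖ := by linarith [norm_nonneg y]
  have hb0 : 0 ≤ C * (1 + ‖y‖) ^ N := by positivity
  have h1 : C * (1 + ‖y‖) ^ N ≤ C * (1 + ‖y‖) ^ (N + 1) :=
    mul_le_mul_of_nonneg_left (pow_le_pow_right₀ hone (Nat.le_succ N)) hC
  calc ‖rotGen (U y) - fderiv ℝ U y (rotGen y)‖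
      ≤ ‖rotGen (U y)‖ + ‖fderiv ℝ U y (rotGen y)‖ := norm_sub_le _ _
    _ ≤ C * (1 + ‖y‖) ^ N + C * (1 + ‖y‖) ^ N * (1 + ‖y‖) := by
        refine add_le_add ((norm_rotGen_le _).trans (hU0 y)) ?_
        exact (ContinuousLinearMap.le_opNorm _ _).trans (mul_le_mul (hU1 y)
          ((norm_rotGen_le y).trans (by linarith [norm_nonneg y])) (norm_nonneg _) hb0)
    _ = C * (1 + ‖y‖) ^ N + C * (1 + ‖y‖) ^ (N + 1) := by ring
    _ ≤ 2 * C * (1 + ‖y‖) ^ (N + 1) := by linarith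

/-- Cauchy–Schwarz in `L²_μ` for continuous fields of polynomial growth (private copy of the
companion file's lemma). [folklore] -/
private theorem abs_integral_gaussWeight_mul_inner_le'
    {A B : EuclideanSpace ℝ (Fin 3) → EuclideanSpace ℝ (Fin 3)} (hA : Continuous A) (hB : Continuous B)
    {C : ℝ} {N : ℕ} (hA0 : ∀ y, ‖A y‖ ≤ C * (1 + ‖y‖) ^ N) (hB0 : ∀ y, ‖B y‖ ≤ C * (1 + ‖y‖) ^ N) :
    |∫ y, gaussWeight y * ⟪A y, B y⟫| ≤
      Real.sqrt (∫ y, gaussWeight y * ‖A y‖ ^ 2) * Real.sqrt (∫ y, gaussWeight y * ‖B y‖ ^ 2) := by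
  have iA : Integrable fun y => gaussWeight y * ‖A y‖ ^ 2 := by
    refine integrable_gaussWeight_mul_of_norm_le (hA.norm.pow 2) (C := C ^ 2) (N := 2 * N) fun y => ?_
    rw [norm_pow, norm_norm]
    calc ‖A y‖ ^ 2 ≤ (C * (1 + ‖y‖) ^ N) ^ 2 := pow_le_pow_left₀ (norm_nonneg _) (hA0 y) 2
      _ = C ^ 2 * (1 + ‖y‖) ^ (2 * N) := by ring
  have iB : Integrable fun y => gaussWeight y * ‖B y‖ ^ 2 := by
    refine integrable_gaussWeight_mul_of_norm_le (hB.norm.pow 2) (C := C ^ 2) (N := 2 * N) fun y => ?_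
    rw [norm_pow, norm_norm]
    calc ‖B y‖ ^ 2 ≤ (C * (1 + ‖y‖) ^ N) ^ 2 := pow_le_pow_left₀ (norm_nonneg _) (hB0 y) 2
      _ = C ^ 2 * (1 + ‖y‖) ^ (2 * N) := by ring
  have iZ : Integrable fun y => gaussWeight y * ⟪A y, B y⟫ := by
    refine integrable_gaussWeight_mul_of_norm_le (hA.inner hB) (C := C ^ 2) (N := 2 * N) fun y => ?_
    calc ‖⟪A y, B y⟫‖ ≤ ‖A y‖ * ‖B y‖ := norm_inner_le_norm _ _
      _ ≤ (C * (1 + ‖y‖) ^ N) * (C * (1 + ‖y‖) ^ N) :=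
          mul_le_mul (hA0 y) (hB0 y) (norm_nonneg _) ((norm_nonneg _).trans (hA0 y))
      _ = C ^ 2 * (1 + ‖y‖) ^ (2 * N) := by ring
  set X := ∫ y, gaussWeight y * ‖A y‖ ^ 2 with hX
  set Y := ∫ y, gaussWeight y * ‖B y‖ ^ 2 with hY
  set Z := ∫ y, gaussWeight y * ⟪A y, B y⟫ with hZ
  have hX0 : 0 ≤ X := integral_nonneg fun y => mul_nonneg (gaussWeight_pos y).le (sq_nonneg _)
  have hY0 : 0 ≤ Y := integral_nonneg fun y => mul_nonneg (gaussWeight_pos y).le (sq_nonneg _)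
  have hq : ∀ t : ℝ, 0 ≤ X * (t * t) + 2 * Z * t + Y := by
    intro t
    have hnn : 0 ≤ ∫ y, gaussWeight y * ‖t • A y + B y‖ ^ 2 :=
      integral_nonneg fun y => mul_nonneg (gaussWeight_pos y).le (sq_nonneg _)
    have e : (fun y => gaussWeight y * ‖t • A y + B y‖ ^ 2) = fun y =>
        (t * t) * (gaussWeight y * ‖A y‖ ^ 2) + 2 * t * (gaussWeight y * ⟪A y, B y⟫) +
          gaussWeight y * ‖B y‖ ^ 2 := by
      funext y
      rw [norm_add_sq_real, norm_smul, real_inner_smul_left, Real.norm_eq_abs, mul_pow, sq_abs]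
      ring
    have i1 : Integrable fun y => (t * t) * (gaussWeight y * ‖A y‖ ^ 2) + 2 * t * (gaussWeight y * ⟪A y, B y⟫) :=
      (iA.const_mul _).add (iZ.const_mul _)
    rw [e, integral_add i1 iB, integral_add (iA.const_mul _) (iZ.const_mul _),
      MeasureTheory.integral_const_mul, MeasureTheory.integral_const_mul] at hnn
    linarith
  have hd := discrim_le_zero hq
  rw [discrim] at hd
  have hZ2 : Z ^ 2 ≤ X * Y := by nlinarith
  calc |Z| = Real.sqrt (Z ^ 2) := (Real.sqrt_sq_eq_abs Z).symm
    _ ≤ Real.sqrt (X * Y) := Real.sqrt_le_sqrt hZ2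
    _ = Real.sqrt X * Real.sqrt Y := Real.sqrt_mul hX0 Y

/-- Minkowski in `L²_μ` for continuous fields of polynomial growth (private copy of the companion
file's lemma). [folklore] -/
private theorem sqrt_integral_gaussWeight_mul_norm_add_sq_le''
    {A B : EuclideanSpace ℝ (Fin 3) → EuclideanSpace ℝ (Fin 3)} (hA : Continuous A) (hB : Continuous B)
    {C : ℝ} {N : ℕ} (hA0 : ∀ y, ‖A y‖ ≤ C * (1 + ‖y‖) ^ N) (hB0 : ∀ y, ‖B y‖ ≤ C * (1 + ‖y‖) ^ N) :
    Real.sqrt (∫ y, gaussWeight y * ‖A y + B y‖ ^ 2) ≤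
      Real.sqrt (∫ y, gaussWeight y * ‖A y‖ ^ 2) + Real.sqrt (∫ y, gaussWeight y * ‖B y‖ ^ 2) := by
  have hCS := abs_integral_gaussWeight_mul_inner_le' hA hB hA0 hB0
  set X := ∫ y, gaussWeight y * ‖A y‖ ^ 2 with hX
  set Y := ∫ y, gaussWeight y * ‖B y‖ ^ 2 with hY
  set Z := ∫ y, gaussWeight y * ⟪A y, B y⟫ with hZ
  have iA : Integrable fun y => gaussWeight y * ‖A y‖ ^ 2 := by
    refine integrable_gaussWeight_mul_of_norm_le (hA.norm.pow 2) (C := C ^ 2) (N := 2 * N) fun y => ?_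
    rw [norm_pow, norm_norm]
    calc ‖A y‖ ^ 2 ≤ (C * (1 + ‖y‖) ^ N) ^ 2 := pow_le_pow_left₀ (norm_nonneg _) (hA0 y) 2
      _ = C ^ 2 * (1 + ‖y‖) ^ (2 * N) := by ring
  have iB : Integrable fun y => gaussWeight y * ‖B y‖ ^ 2 := by
    refine integrable_gaussWeight_mul_of_norm_le (hB.norm.pow 2) (C := C ^ 2) (N := 2 * N) fun y => ?_
    rw [norm_pow, norm_norm]
    calc ‖B y‖ ^ 2 ≤ (C * (1 + ‖y‖) ^ N) ^ 2 := pow_le_pow_left₀ (norm_nonneg _) (hB0 y) 2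
      _ = C ^ 2 * (1 + ‖y‖) ^ (2 * N) := by ring
  have iZ : Integrable fun y => gaussWeight y * ⟪A y, B y⟫ := by
    refine integrable_gaussWeight_mul_of_norm_le (hA.inner hB) (C := C ^ 2) (N := 2 * N) fun y => ?_
    calc ‖⟪A y, B y⟫‖ ≤ ‖A y‖ * ‖B y‖ := norm_inner_le_norm _ _
      _ ≤ (C * (1 + ‖y‖) ^ N) * (C * (1 + ‖y‖) ^ N) :=
          mul_le_mul (hA0 y) (hB0 y) (norm_nonneg _) ((norm_nonneg _).trans (hA0 y))
      _ = C ^ 2 * (1 + ‖y‖) ^ (2 * N) := by ring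
  have hX0 : 0 ≤ X := integral_nonneg fun y => mul_nonneg (gaussWeight_pos y).le (sq_nonneg _)
  have hY0 : 0 ≤ Y := integral_nonneg fun y => mul_nonneg (gaussWeight_pos y).le (sq_nonneg _)
  have e : ∫ y, gaussWeight y * ‖A y + B y‖ ^ 2 = X + 2 * Z + Y := by
    have e1 : (fun y => gaussWeight y * ‖A y + B y‖ ^ 2) = fun y =>
        (gaussWeight y * ‖A y‖ ^ 2 + 2 * (gaussWeight y * ⟪A y, B y⟫)) + gaussWeight y * ‖B y‖ ^ 2 := by
      funext y; rw [norm_add_sq_real]; ring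
    have i1 : Integrable fun y => gaussWeight y * ‖A y‖ ^ 2 + 2 * (gaussWeight y * ⟪A y, B y⟫) :=
      (iA.add (iZ.const_mul _) :)
    rw [e1, integral_add i1 iB, integral_add iA (iZ.const_mul _), MeasureTheory.integral_const_mul]
  rw [e]
  have h1 : X + 2 * Z + Y ≤ (Real.sqrt X + Real.sqrt Y) ^ 2 := by
    rw [add_sq, Real.sq_sqrt hX0, Real.sq_sqrt hY0]
    have : Z ≤ Real.sqrt X * Real.sqrt Y := (le_abs_self Z).trans hCS
    linarith
  calc Real.sqrt (X + 2 * Z + Y) ≤ Real.sqrt ((Real.sqrt X + Real.sqrt Y) ^ 2) := Real.sqrt_le_sqrt h1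
    _ = Real.sqrt X + Real.sqrt Y :=
        Real.sqrt_sq (add_nonneg (Real.sqrt_nonneg _) (Real.sqrt_nonneg _))

/-! ### Lemma 6.4 and the Proposition 6.5 algebra for a general source `𝓢` -/

variable {U 𝓢 : EuclideanSpace ℝ (Fin 3) → EuclideanSpace ℝ (Fin 3)} {α : ℝ} {C : ℝ} {N : ℕ}

/-- **(6.18) for a general source** ("arguing exactly as in the proof of Proposition 6.5", p. 28;
proof of Lemma 6.4, p. 21): if `U ∈ C²` of polynomial growth solves
`α𝓡U + ½U + ½DU[y] − ΔU = 𝓢` with `𝓢` continuous of polynomial growth, then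
`|α| ‖𝓡U‖²_{L²_μ} ≤ ‖𝓡U‖_{L²_μ} ‖(𝓢)_a‖_{L²_μ}` — by `⟨𝓡U, U⟩_γ = 0`, `⟨(−Δ + ½y·∇)U, 𝓡U⟩_γ = 0`,
`⟨𝓡U, 𝓢⟩_γ = ⟨𝓡U, (𝓢)_a⟩_γ` (Lemma 6.2 (ii)) and Cauchy–Schwarz.
[cite: PineauVicol2026, proof of Lemma 6.4, (6.18) (p. 21); proof of Proposition 8.3 (p. 28)] -/
theorem abs_mul_integral_gaussWeight_mul_norm_rotOp_sq_le_of_source (hU : ContDiff ℝ 2 U)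
    (hU0 : ∀ y, ‖U y‖ ≤ C * (1 + ‖y‖) ^ N) (hU1 : ∀ y, ‖fderiv ℝ U y‖ ≤ C * (1 + ‖y‖) ^ N)
    (hU2 : ∀ y, ‖fderiv ℝ (fderiv ℝ U) y‖ ≤ C * (1 + ‖y‖) ^ N)
    (hS : Continuous 𝓢) (hS0 : ∀ y, ‖𝓢 y‖ ≤ C * (1 + ‖y‖) ^ N)
    (heq : ∀ y, α • (rotGen (U y) - fderiv ℝ U y (rotGen y)) + (1 / 2 : ℝ) • U y +
      (1 / 2 : ℝ) • fderiv ℝ U y y - (Δ U) y = 𝓢 y) :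
    |α| * ∫ y, gaussWeight y * ‖rotGen (U y) - fderiv ℝ U y (rotGen y)‖ ^ 2 ≤
      Real.sqrt (∫ y, gaussWeight y * ‖rotGen (U y) - fderiv ℝ U y (rotGen y)‖ ^ 2) *
        Real.sqrt (∫ y, gaussWeight y * ‖angularFluctVec 𝓢 y‖ ^ 2) := by
  have hC : 0 ≤ C := nonneg_of_norm_le' hU0
  have hU1' : ContDiff ℝ 1 U := hU.of_le one_le_two
  have cR : Continuous fun y => rotGen (U y) - fderiv ℝ U y (rotGen y) := continuous_rotOp' hU1'
  have hone : ∀ y : EuclideanSpace ℝ (Fin 3), (1 : ℝ) ≤ 1 + ‖y‖ := fun y => by linarith [norm_nonneg y]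
  -- a common growth bound `K (1+|y|)^(N+1)` for `U`, `DU`, `𝓡U`, `𝓢`
  have hR0 : ∀ y, ‖rotGen (U y) - fderiv ℝ U y (rotGen y)‖ ≤ 2 * C * (1 + ‖y‖) ^ (N + 1) :=
    norm_rotOp_le'' hU0 hU1
  have up : ∀ y : EuclideanSpace ℝ (Fin 3), C * (1 + ‖y‖) ^ N ≤ 2 * C * (1 + ‖y‖) ^ (N + 1) := by
    intro y
    have h1 : (1 + ‖y‖) ^ N ≤ (1 + ‖y‖) ^ (N + 1) := pow_le_pow_right₀ (hone y) (Nat.le_succ N)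
    nlinarith [pow_nonneg (zero_le_one.trans (hone y)) N]
  have hU0' : ∀ y, ‖U y‖ ≤ 2 * C * (1 + ‖y‖) ^ (N + 1) := fun y => (hU0 y).trans (up y)
  have hU1'' : ∀ y, ‖fderiv ℝ U y‖ ≤ 2 * C * (1 + ‖y‖) ^ (N + 1) := fun y => (hU1 y).trans (up y)
  have hS0' : ∀ y, ‖𝓢 y‖ ≤ 2 * C * (1 + ‖y‖) ^ (N + 1) := fun y => (hS0 y).trans (up y)
  -- `𝓢 = α𝓡U + ½U + (−ΔU + ½DU[y])`
  have hOU : ∀ y, -(Δ U) y + (1 / 2 : ℝ) • fderiv ℝ U y y =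
      𝓢 y - α • (rotGen (U y) - fderiv ℝ U y (rotGen y)) - (1 / 2 : ℝ) • U y := by
    intro y; rw [← heq y]; abel
  -- integrability
  have iR : Integrable fun y => gaussWeight y * ‖rotGen (U y) - fderiv ℝ U y (rotGen y)‖ ^ 2 := by
    refine integrable_gaussWeight_mul_of_norm_le (cR.norm.pow 2) (C := (2 * C) ^ 2) (N := 2 * (N + 1))
      fun y => ?_
    rw [norm_pow, norm_norm]
    calc ‖rotGen (U y) - fderiv ℝ U y (rotGen y)‖ ^ 2 ≤ (2 * C * (1 + ‖y‖) ^ (N + 1)) ^ 2 :=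
          pow_le_pow_left₀ (norm_nonneg _) (hR0 y) 2
      _ = (2 * C) ^ 2 * (1 + ‖y‖) ^ (2 * (N + 1)) := by ring
  have iRS : Integrable fun y => gaussWeight y * ⟪rotGen (U y) - fderiv ℝ U y (rotGen y), 𝓢 y⟫ := by
    refine integrable_gaussWeight_mul_of_norm_le (cR.inner hS) (C := (2 * C) ^ 2) (N := 2 * (N + 1))
      fun y => ?_
    calc ‖⟪rotGen (U y) - fderiv ℝ U y (rotGen y), 𝓢 y⟫‖
        ≤ ‖rotGen (U y) - fderiv ℝ U y (rotGen y)‖ * ‖𝓢 y‖ := norm_inner_le_norm _ _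
      _ ≤ (2 * C * (1 + ‖y‖) ^ (N + 1)) * (2 * C * (1 + ‖y‖) ^ (N + 1)) :=
          mul_le_mul (hR0 y) (hS0' y) (norm_nonneg _) ((norm_nonneg _).trans (hR0 y))
      _ = (2 * C) ^ 2 * (1 + ‖y‖) ^ (2 * (N + 1)) := by ring
  have iRU : Integrable fun y => gaussWeight y * ⟪rotGen (U y) - fderiv ℝ U y (rotGen y), U y⟫ := by
    refine integrable_gaussWeight_mul_of_norm_le (cR.inner hU.continuous) (C := (2 * C) ^ 2)
      (N := 2 * (N + 1)) fun y => ?_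
    calc ‖⟪rotGen (U y) - fderiv ℝ U y (rotGen y), U y⟫‖
        ≤ ‖rotGen (U y) - fderiv ℝ U y (rotGen y)‖ * ‖U y‖ := norm_inner_le_norm _ _
      _ ≤ (2 * C * (1 + ‖y‖) ^ (N + 1)) * (2 * C * (1 + ‖y‖) ^ (N + 1)) :=
          mul_le_mul (hR0 y) (hU0' y) (norm_nonneg _) ((norm_nonneg _).trans (hR0 y))
      _ = (2 * C) ^ 2 * (1 + ‖y‖) ^ (2 * (N + 1)) := by ring
  -- `α ‖𝓡U‖² = ⟨𝓡U, 𝓢⟩`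
  have h618 : α * ∫ y, gaussWeight y * ‖rotGen (U y) - fderiv ℝ U y (rotGen y)‖ ^ 2 =
      ∫ y, gaussWeight y * ⟪rotGen (U y) - fderiv ℝ U y (rotGen y), 𝓢 y⟫ := by
    have hz1 := integral_gaussWeight_mul_inner_rotOp_self_eq_zero hU1' hU0 hU1
    have hz2 : ∫ y, gaussWeight y * ⟪rotGen (U y) - fderiv ℝ U y (rotGen y),
        -(Δ U) y + (1 / 2 : ℝ) • fderiv ℝ U y y⟫ = 0 := by
      rw [← integral_gaussWeight_mul_inner_ou_rotOp_eq_zero hU hU0 hU1 hU2]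
      refine integral_congr_ae (Eventually.of_forall fun y => ?_)
      exact congrArg (fun t => gaussWeight y * t) (real_inner_comm _ _)
    have e : (fun y => gaussWeight y * ⟪rotGen (U y) - fderiv ℝ U y (rotGen y), 𝓢 y⟫) = fun y =>
        α * (gaussWeight y * ‖rotGen (U y) - fderiv ℝ U y (rotGen y)‖ ^ 2) +
          (1 / 2 : ℝ) * (gaussWeight y * ⟪rotGen (U y) - fderiv ℝ U y (rotGen y), U y⟫) +
          gaussWeight y * ⟪rotGen (U y) - fderiv ℝ U y (rotGen y),
            -(Δ U) y + (1 / 2 : ℝ) • fderiv ℝ U y y⟫ := by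
      funext y
      have hSy : 𝓢 y = α • (rotGen (U y) - fderiv ℝ U y (rotGen y)) + (1 / 2 : ℝ) • U y +
          (-(Δ U) y + (1 / 2 : ℝ) • fderiv ℝ U y y) := by rw [← heq y]; abel
      rw [hSy]
      generalize rotGen (U y) - fderiv ℝ U y (rotGen y) = r
      simp only [inner_add_right, inner_smul_right, real_inner_self_eq_norm_sq]
      ring
    have i12 : Integrable fun y => α * (gaussWeight y * ‖rotGen (U y) - fderiv ℝ U y (rotGen y)‖ ^ 2) +
        (1 / 2 : ℝ) * (gaussWeight y * ⟪rotGen (U y) - fderiv ℝ U y (rotGen y), U y⟫) :=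
      ((iR.const_mul α).add (iRU.const_mul (1 / 2 : ℝ)) :)
    have iOU : Integrable fun y => gaussWeight y * ⟪rotGen (U y) - fderiv ℝ U y (rotGen y),
        -(Δ U) y + (1 / 2 : ℝ) • fderiv ℝ U y y⟫ := by
      have e2 : (fun y => gaussWeight y * ⟪rotGen (U y) - fderiv ℝ U y (rotGen y),
          -(Δ U) y + (1 / 2 : ℝ) • fderiv ℝ U y y⟫) = fun y =>
          gaussWeight y * ⟪rotGen (U y) - fderiv ℝ U y (rotGen y), 𝓢 y⟫ -
            (α * (gaussWeight y * ‖rotGen (U y) - fderiv ℝ U y (rotGen y)‖ ^ 2) +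
              (1 / 2 : ℝ) * (gaussWeight y * ⟪rotGen (U y) - fderiv ℝ U y (rotGen y), U y⟫)) := by
        funext y
        have := congrFun e y
        linarith
      rw [e2]
      exact iRS.sub i12
    rw [e, integral_add i12 iOU, integral_add (iR.const_mul α) (iRU.const_mul _),
      MeasureTheory.integral_const_mul, MeasureTheory.integral_const_mul, hz1, hz2]
    ring
  -- `⟨𝓡U, 𝓢⟩ = ⟨𝓡U, (𝓢)_a⟩`, then Cauchy–Schwarz
  rw [show |α| * ∫ y, gaussWeight y * ‖rotGen (U y) - fderiv ℝ U y (rotGen y)‖ ^ 2 =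
      |α * ∫ y, gaussWeight y * ‖rotGen (U y) - fderiv ℝ U y (rotGen y)‖ ^ 2| by
    rw [abs_mul, abs_of_nonneg (integral_nonneg fun y => mul_nonneg (gaussWeight_pos y).le (sq_nonneg _))],
    h618, integral_gaussWeight_mul_inner_rotOp_eq_angularFluctVec hU1' hS hU0' hU1'' hS0']
  have hSa : ∀ y, ‖angularFluctVec 𝓢 y‖ ≤ (2 * (2 * C)) * (1 + ‖y‖) ^ (N + 1) := fun y => by
    have := norm_angularFluctVec_le (b := fun r => 2 * C * (1 + r) ^ (N + 1)) hS0' y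
    simpa [mul_assoc] using this
  have hR0' : ∀ y, ‖rotGen (U y) - fderiv ℝ U y (rotGen y)‖ ≤ (2 * (2 * C)) * (1 + ‖y‖) ^ (N + 1) :=
    fun y => (hR0 y).trans (by nlinarith [pow_nonneg (zero_le_one.trans (hone y)) (N + 1)])
  exact abs_integral_gaussWeight_mul_inner_le' cR ((hS.sub (continuous_angularMeanVec hS) :)) hR0' hSa

/-- **(6.19) for a general source** (proof of Lemma 6.4, p. 22; "arguing exactly as in the proof
of Proposition 6.5", p. 28): `½‖(U)_a‖²_{L²_μ} + ‖∇(U)_a‖²_{L²_μ} ≤ 2‖(𝓢)_a‖_{L²_μ}‖𝓡U‖_{L²_μ}`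
(the identity `½‖(U)_a‖² + ‖∇(U)_a‖² = ⟨(𝓢)_a, (U)_a⟩_γ` of the companion file, Cauchy–Schwarz
and the angular Poincaré inequality (6.9)). [cite: PineauVicol2026, proof of Lemma 6.4, (6.19) (p. 22)] -/
theorem half_norm_sq_add_le_of_source (hU : ContDiff ℝ 2 U)
    (hU0 : ∀ y, ‖U y‖ ≤ C * (1 + ‖y‖) ^ N) (hU1 : ∀ y, ‖fderiv ℝ U y‖ ≤ C * (1 + ‖y‖) ^ N)
    (hU2 : ∀ y, ‖fderiv ℝ (fderiv ℝ U) y‖ ≤ C * (1 + ‖y‖) ^ N)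
    (hS : Continuous 𝓢) (hS0 : ∀ y, ‖𝓢 y‖ ≤ C * (1 + ‖y‖) ^ N)
    (heq : ∀ y, α • (rotGen (U y) - fderiv ℝ U y (rotGen y)) + (1 / 2 : ℝ) • U y +
      (1 / 2 : ℝ) • fderiv ℝ U y y - (Δ U) y = 𝓢 y) :
    (1 / 2 : ℝ) * (∫ y, gaussWeight y * ‖angularFluctVec U y‖ ^ 2) +
        (∫ y, gaussWeight y * ∑ i, ‖fderiv ℝ (angularFluctVec U) y (EuclideanSpace.basisFun (Fin 3) ℝ i)‖ ^ 2) ≤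
      2 * Real.sqrt (∫ y, gaussWeight y * ‖angularFluctVec 𝓢 y‖ ^ 2) *
        Real.sqrt (∫ y, gaussWeight y * ‖rotGen (U y) - fderiv ℝ U y (rotGen y)‖ ^ 2) := by
  have hU1' : ContDiff ℝ 1 U := hU.of_le one_le_two
  rw [half_mul_integral_gaussWeight_mul_norm_sq_angularFluctVec_add hU hU0 hU1 hU2 hS hS0 heq]
  have bS : ∀ y, ‖angularFluctVec 𝓢 y‖ ≤ (2 * C) * (1 + ‖y‖) ^ N := fun y => by
    simpa [mul_assoc] using norm_angularFluctVec_le (b := fun r => C * (1 + r) ^ N) hS0 y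
  have bU : ∀ y, ‖angularFluctVec U y‖ ≤ (2 * C) * (1 + ‖y‖) ^ N := fun y => by
    simpa [mul_assoc] using norm_angularFluctVec_le (b := fun r => C * (1 + r) ^ N) hU0 y
  have cSa : Continuous (angularFluctVec 𝓢) := (hS.sub (continuous_angularMeanVec hS) :)
  have cUa : Continuous (angularFluctVec U) := (hU.continuous.sub (continuous_angularMeanVec hU.continuous) :)
  have hCS := abs_integral_gaussWeight_mul_inner_le' cSa cUa bS bU
  have hP := sqrt_integral_gaussWeight_mul_norm_sq_angularFluctVec_le hU1' hU0 hU1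
  have h0 : 0 ≤ Real.sqrt (∫ y, gaussWeight y * ‖angularFluctVec 𝓢 y‖ ^ 2) := Real.sqrt_nonneg _
  calc ∫ y, gaussWeight y * ⟪angularFluctVec 𝓢 y, angularFluctVec U y⟫
      ≤ Real.sqrt (∫ y, gaussWeight y * ‖angularFluctVec 𝓢 y‖ ^ 2) *
          Real.sqrt (∫ y, gaussWeight y * ‖angularFluctVec U y‖ ^ 2) := (le_abs_self _).trans hCS
    _ ≤ Real.sqrt (∫ y, gaussWeight y * ‖angularFluctVec 𝓢 y‖ ^ 2) *
          (2 * Real.sqrt (∫ y, gaussWeight y * ‖rotGen (U y) - fderiv ℝ U y (rotGen y)‖ ^ 2)) :=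
        mul_le_mul_of_nonneg_left hP h0
    _ = _ := by ring

/-- **Lemma 6.4 (6.17) for a general source**:
`|α|‖𝓡U‖²_{L²_μ} + ½‖(U)_a‖²_{L²_μ} + ‖∇(U)_a‖²_{L²_μ} ≤ 3‖𝓡U‖_{L²_μ}‖(𝓢)_a‖_{L²_μ}` ("Adding (6.18)
and (6.19)"). [cite: PineauVicol2026, Lemma 6.4, (6.17) (p. 21); proof of Proposition 8.3 (p. 28)] -/
theorem pineauVicol_lemma_6_4_of_source (hU : ContDiff ℝ 2 U)
    (hU0 : ∀ y, ‖U y‖ ≤ C * (1 + ‖y‖) ^ N) (hU1 : ∀ y, ‖fderiv ℝ U y‖ ≤ C * (1 + ‖y‖) ^ N)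
    (hU2 : ∀ y, ‖fderiv ℝ (fderiv ℝ U) y‖ ≤ C * (1 + ‖y‖) ^ N)
    (hS : Continuous 𝓢) (hS0 : ∀ y, ‖𝓢 y‖ ≤ C * (1 + ‖y‖) ^ N)
    (heq : ∀ y, α • (rotGen (U y) - fderiv ℝ U y (rotGen y)) + (1 / 2 : ℝ) • U y +
      (1 / 2 : ℝ) • fderiv ℝ U y y - (Δ U) y = 𝓢 y) :
    |α| * (∫ y, gaussWeight y * ‖rotGen (U y) - fderiv ℝ U y (rotGen y)‖ ^ 2) +
        (1 / 2 : ℝ) * (∫ y, gaussWeight y * ‖angularFluctVec U y‖ ^ 2) +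
        (∫ y, gaussWeight y * ∑ i, ‖fderiv ℝ (angularFluctVec U) y (EuclideanSpace.basisFun (Fin 3) ℝ i)‖ ^ 2) ≤
      3 * Real.sqrt (∫ y, gaussWeight y * ‖rotGen (U y) - fderiv ℝ U y (rotGen y)‖ ^ 2) *
        Real.sqrt (∫ y, gaussWeight y * ‖angularFluctVec 𝓢 y‖ ^ 2) := by
  have h1 := abs_mul_integral_gaussWeight_mul_norm_rotOp_sq_le_of_source hU hU0 hU1 hU2 hS hS0 heq
  have h2 := half_norm_sq_add_le_of_source hU hU0 hU1 hU2 hS hS0 heq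
  linarith

/-- **The Proposition 6.5 algebra for a general source** (p. 22; "arguing exactly as in the proof
of Proposition 6.5", p. 28): if `‖(𝓢)_a‖_{L²_μ} ≤ ε/6 + C_ε‖(U)_a‖_{L²_μ} + C_ε‖∇(U)_a‖_{L²_μ}` and
`|α| ≥ (27/2)C_ε²`, then `|α| ‖𝓡U‖_{L²_μ} ≤ ε` — (6.17), Young's inequality and absorption exactly
as printed. [cite: PineauVicol2026, proof of Proposition 6.5 (p. 22); Proposition 8.3 (p. 28)] -/
theorem pineauVicol_prop_6_5_of_source (hU : ContDiff ℝ 2 U)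
    (hU0 : ∀ y, ‖U y‖ ≤ C * (1 + ‖y‖) ^ N) (hU1 : ∀ y, ‖fderiv ℝ U y‖ ≤ C * (1 + ‖y‖) ^ N)
    (hU2 : ∀ y, ‖fderiv ℝ (fderiv ℝ U) y‖ ≤ C * (1 + ‖y‖) ^ N)
    (hS : Continuous 𝓢) (hS0 : ∀ y, ‖𝓢 y‖ ≤ C * (1 + ‖y‖) ^ N)
    (heq : ∀ y, α • (rotGen (U y) - fderiv ℝ U y (rotGen y)) + (1 / 2 : ℝ) • U y +
      (1 / 2 : ℝ) • fderiv ℝ U y y - (Δ U) y = 𝓢 y)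
    {ε Cε : ℝ} (hε : 0 ≤ ε)
    (h611 : Real.sqrt (∫ y, gaussWeight y * ‖angularFluctVec 𝓢 y‖ ^ 2) ≤
      ε / 6 + Cε * Real.sqrt (∫ y, gaussWeight y * ‖angularFluctVec U y‖ ^ 2) +
        Cε * Real.sqrt (∫ y, gaussWeight y *
          ∑ i, ‖fderiv ℝ (angularFluctVec U) y (EuclideanSpace.basisFun (Fin 3) ℝ i)‖ ^ 2))
    (hα : 27 / 2 * Cε ^ 2 ≤ |α|) :
    |α| * Real.sqrt (∫ y, gaussWeight y * ‖rotGen (U y) - fderiv ℝ U y (rotGen y)‖ ^ 2) ≤ ε := by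
  have h64 := pineauVicol_lemma_6_4_of_source hU hU0 hU1 hU2 hS hS0 heq
  have iR0 : 0 ≤ ∫ y, gaussWeight y * ‖rotGen (U y) - fderiv ℝ U y (rotGen y)‖ ^ 2 :=
    integral_nonneg fun y => mul_nonneg (gaussWeight_pos y).le (sq_nonneg _)
  have iU0 : 0 ≤ ∫ y, gaussWeight y * ‖angularFluctVec U y‖ ^ 2 :=
    integral_nonneg fun y => mul_nonneg (gaussWeight_pos y).le (sq_nonneg _)
  have iG0 : 0 ≤ ∫ y, gaussWeight y *
      ∑ i, ‖fderiv ℝ (angularFluctVec U) y (EuclideanSpace.basisFun (Fin 3) ℝ i)‖ ^ 2 :=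
    integral_nonneg fun y => mul_nonneg (gaussWeight_pos y).le (Finset.sum_nonneg fun i _ => sq_nonneg _)
  set R := Real.sqrt (∫ y, gaussWeight y * ‖rotGen (U y) - fderiv ℝ U y (rotGen y)‖ ^ 2) with hR
  set Na := Real.sqrt (∫ y, gaussWeight y * ‖angularFluctVec 𝓢 y‖ ^ 2) with hNa
  set Ua := Real.sqrt (∫ y, gaussWeight y * ‖angularFluctVec U y‖ ^ 2) with hUa
  set Ga := Real.sqrt (∫ y, gaussWeight y *
    ∑ i, ‖fderiv ℝ (angularFluctVec U) y (EuclideanSpace.basisFun (Fin 3) ℝ i)‖ ^ 2) with hGa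
  have eR : ∫ y, gaussWeight y * ‖rotGen (U y) - fderiv ℝ U y (rotGen y)‖ ^ 2 = R ^ 2 :=
    (Real.sq_sqrt iR0).symm
  have eU : ∫ y, gaussWeight y * ‖angularFluctVec U y‖ ^ 2 = Ua ^ 2 := (Real.sq_sqrt iU0).symm
  have eG : ∫ y, gaussWeight y *
      ∑ i, ‖fderiv ℝ (angularFluctVec U) y (EuclideanSpace.basisFun (Fin 3) ℝ i)‖ ^ 2 = Ga ^ 2 :=
    (Real.sq_sqrt iG0).symm
  rw [eR, eU, eG] at h64
  have hR0 : 0 ≤ R := Real.sqrt_nonneg _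
  have hNa0 : 0 ≤ Na := Real.sqrt_nonneg _
  have hUa0 : 0 ≤ Ua := Real.sqrt_nonneg _
  have hGa0 : 0 ≤ Ga := Real.sqrt_nonneg _
  have ha0 : 0 ≤ |α| := abs_nonneg _
  have h1 : |α| * R ^ 2 + 1 / 2 * Ua ^ 2 + Ga ^ 2 ≤ 3 * R * (ε / 6 + Cε * Ua + Cε * Ga) :=
    h64.trans (mul_le_mul_of_nonneg_left h611 (by positivity))
  have h2 : |α| * R ^ 2 ≤ 1 / 2 * ε * R + 27 / 4 * Cε ^ 2 * R ^ 2 := by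
    nlinarith [sq_nonneg (Ua - 3 * Cε * R), sq_nonneg (Ga - 3 / 2 * Cε * R)]
  have h3 : |α| * R ^ 2 ≤ ε * R := by nlinarith [sq_nonneg R]
  rcases hR0.eq_or_lt with h | h
  · rw [← h, mul_zero]; exact hε
  · have : |α| * R * R ≤ ε * R := by nlinarith
    exact le_of_mul_le_mul_right this h

/-! ### The slice term of (8.4): `‖(∂_sU)_a‖_{L²_μ} ≤ ‖∂_sU‖_{L²_μ} ≤ (sup|∂_sU|)·‖1‖_{L²_μ}` -/

/-- `γ` is integrable. [folklore] -/
private theorem integrable_gaussWeight' : Integrable fun y : EuclideanSpace ℝ (Fin 3) => gaussWeight y := by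
  have h := integrable_gaussWeight_mul_of_norm_le (g := fun _ => (1 : ℝ)) continuous_const (C := 1) (N := 0)
    (fun y => by simp)
  simpa using h

/-- **"`‖(∂_sU)_a‖_{L²_μ} ≤ ‖∂_sU‖_{L²_μ} ≤ C_{U,s}S(1+|α|)²‖(1+|y|)⁻¹‖_{L²_μ}`" (proof of Lemma 8.2,
p. 28), in the form used**: for continuous fields `A` (polynomial growth) and `F` with `|F| ≤ m`,
`‖(A − F)_a‖_{L²_μ} ≤ ‖(A)_a‖_{L²_μ} + m (∫γ)^{1/2}` (Minkowski, `‖(F)_a‖_{L²_μ} ≤ ‖F‖_{L²_μ}`, and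
`‖(1+|y|)⁻¹‖_{L²_μ} ≤ ‖1‖_{L²_μ} = (∫γ)^{1/2}`). [cite: PineauVicol2026, proof of Lemma 8.2 (p. 28)] -/
theorem sqrt_integral_gaussWeight_angularFluctVec_sub_le
    {A F : EuclideanSpace ℝ (Fin 3) → EuclideanSpace ℝ (Fin 3)} (hA : Continuous A) (hF : Continuous F)
    {K : ℝ} {N : ℕ} (hA0 : ∀ y, ‖A y‖ ≤ K * (1 + ‖y‖) ^ N) {m : ℝ} (hF0 : ∀ y, ‖F y‖ ≤ m) :
    Real.sqrt (∫ y, gaussWeight y * ‖angularFluctVec (fun x => A x - F x) y‖ ^ 2) ≤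
      Real.sqrt (∫ y, gaussWeight y * ‖angularFluctVec A y‖ ^ 2) +
        m * Real.sqrt (∫ y : EuclideanSpace ℝ (Fin 3), gaussWeight y) := by
  have hK : 0 ≤ K := nonneg_of_norm_le' hA0
  have hm : 0 ≤ m := (norm_nonneg _).trans (hF0 0)
  have hone : ∀ y : EuclideanSpace ℝ (Fin 3), (1 : ℝ) ≤ (1 + ‖y‖) ^ N := fun y =>
    one_le_pow₀ (by linarith [norm_nonneg y])
  have hF0' : ∀ y, ‖F y‖ ≤ m * (1 + ‖y‖) ^ N := fun y =>
    (hF0 y).trans (le_mul_of_one_le_right hm (hone y))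
  -- `(A − F)_a = (A)_a + (−(F)_a)`
  have hsplit : ∀ y, angularFluctVec (fun x => A x - F x) y =
      angularFluctVec A y + -angularFluctVec F y := fun y => by
    rw [angularFluctVec_apply, angularFluctVec_apply, angularFluctVec_apply, angularMeanVec_sub hA hF]
    abel
  simp_rw [hsplit]
  have cAa : Continuous (angularFluctVec A) := (hA.sub (continuous_angularMeanVec hA) :)
  have cFa : Continuous fun y => -angularFluctVec F y := (hF.sub (continuous_angularMeanVec hF) :).neg
  have bA : ∀ y, ‖angularFluctVec A y‖ ≤ (2 * K + 2 * m) * (1 + ‖y‖) ^ N := fun y => by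
    have h := norm_angularFluctVec_le (b := fun r => K * (1 + r) ^ N) hA0 y
    nlinarith [hone y, h]
  have bF : ∀ y, ‖-angularFluctVec F y‖ ≤ (2 * K + 2 * m) * (1 + ‖y‖) ^ N := fun y => by
    have h := norm_angularFluctVec_le (b := fun r => m * (1 + r) ^ N) hF0' y
    rw [norm_neg]
    nlinarith [hone y, h]
  have hM := sqrt_integral_gaussWeight_mul_norm_add_sq_le'' cAa cFa bA bF
  refine hM.trans (add_le_add le_rfl ?_)
  simp_rw [norm_neg]
  -- `‖(F)_a‖_{L²_μ} ≤ ‖F‖_{L²_μ} ≤ m (∫γ)^{1/2}`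
  have h1 := sqrt_integral_gaussWeight_mul_norm_sq_angularFluctVec_le_self hF hF0'
  refine h1.trans ?_
  have iγ := integrable_gaussWeight'
  have h2 : ∫ y, gaussWeight y * ‖F y‖ ^ 2 ≤ m ^ 2 * ∫ y : EuclideanSpace ℝ (Fin 3), gaussWeight y := by
    rw [← MeasureTheory.integral_const_mul]
    refine integral_mono_of_nonneg (Eventually.of_forall fun y =>
      mul_nonneg (gaussWeight_pos y).le (sq_nonneg _)) (iγ.const_mul _) (Eventually.of_forall fun y => ?_)
    have := pow_le_pow_left₀ (norm_nonneg _) (hF0 y) 2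
    have hγ := (gaussWeight_pos y).le
    nlinarith
  calc Real.sqrt (∫ y, gaussWeight y * ‖F y‖ ^ 2) ≤ Real.sqrt (m ^ 2 * ∫ y, gaussWeight y) :=
        Real.sqrt_le_sqrt h2
    _ = m * Real.sqrt (∫ y : EuclideanSpace ℝ (Fin 3), gaussWeight y) := by
        rw [Real.sqrt_mul (sq_nonneg m), Real.sqrt_sq hm]

/-! ### (8.5) and Lemma 8.2 on a time slice -/

/-- **Pineau–Vicol 2026, Lemma 8.2 (8.5) on a time slice, explicit constants**: with
`𝓝 = −(U·∇)U − ∇P − F` (8.4) (`F = ∂_sU(·, s)`), `U, P` in the class of Lemma 6.3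
(`PineauVicolPressure.lean`) and the slice derivative obeying the first bound of (8.2),
`|F(y)| ≤ C_{U,s}S(1 + |α|)²(1 + |y|)⁻¹` (`S ≥ 0` the period):
`‖(𝓝)_a‖_{L²_μ} ≤ ε + C_ε‖(U)_a‖_{L²_μ} + C_ε‖∇(U)_a‖_{L²_μ} + C_{U,s}S(1+|α|)²(∫γ)^{1/2}` with the
constant `C_ε` of (6.11) ("the estimate for `−(U·∇U) − ∇P` is identical to that in Lemma 6.3 …
`‖(∂_sU)_a‖_{L²_μ} ≤ ‖∂_sU‖_{L²_μ} ≤ C_{U,s}S(1+|α|)²‖(1+|y|)⁻¹‖_{L²_μ}`").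
[cite: PineauVicol2026, Lemma 8.2 (8.5) and its proof (p. 28)] -/
theorem pineauVicol_8_5 {U F : EuclideanSpace ℝ (Fin 3) → EuclideanSpace ℝ (Fin 3)}
    {P : EuclideanSpace ℝ (Fin 3) → ℝ} (hU : ContDiff ℝ 2 U) (hP : ContDiff ℝ 2 P) {C₀ C₁ CP s : ℝ}
    (h19 : ∀ y, ‖U y‖ ≤ C₀ / (1 + ‖y‖)) (h21 : ∀ y, ‖fderiv ℝ U y‖ ≤ C₁ / (1 + ‖y‖ ^ 2))
    (hs : 3 / 2 < s) (h22 : ∀ y, |P y| ≤ CP / (1 + ‖y‖ ^ s))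
    (hPois : ∀ y, Δ P y = -VectorCalculus.divergence (convect U U) y)
    {C : ℝ} {N : ℕ} (hP1 : ∀ y, ‖gradient P y‖ ≤ C * (1 + ‖y‖) ^ N)
    (hF : Continuous F) {Cs Sper α : ℝ}
    (h82 : ∀ y, ‖F y‖ ≤ Cs * Sper * (1 + |α|) ^ 2 / (1 + ‖y‖)) {ε : ℝ} (hε : 0 < ε) :
    Real.sqrt (∫ y, gaussWeight y *
        ‖angularFluctVec (fun x => -(convect U U x) - gradient P x - F x) y‖ ^ 2) ≤
      ε + (1 + 9 * Real.exp ((max 1 ((24 * (C₀ * C₁) / ε) ^ ((2 : ℝ) / 3))) ^ 2 / 8)) * (C₁ + 3 * C₀) *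
          Real.sqrt (∫ y, gaussWeight y * ‖angularFluctVec U y‖ ^ 2) +
        (1 + 9 * Real.exp ((max 1 ((24 * (C₀ * C₁) / ε) ^ ((2 : ℝ) / 3))) ^ 2 / 8)) * (C₁ + 3 * C₀) *
          Real.sqrt (∫ y, gaussWeight y *
            ∑ i, ‖fderiv ℝ (angularFluctVec U) y (EuclideanSpace.basisFun (Fin 3) ℝ i)‖ ^ 2) +
        Cs * Sper * (1 + |α|) ^ 2 * Real.sqrt (∫ y : EuclideanSpace ℝ (Fin 3), gaussWeight y) := by
  have hC0 : 0 ≤ C₀ := by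
    have h := (norm_nonneg _).trans (h19 0); rw [norm_zero] at h; norm_num at h; exact h
  have hC1 : 0 ≤ C₁ := by
    have h := (norm_nonneg _).trans (h21 0); rw [norm_zero] at h; norm_num at h; exact h
  have hCC : 0 ≤ C := nonneg_of_norm_le' hP1
  have hm : 0 ≤ Cs * Sper * (1 + |α|) ^ 2 := by
    have h := (norm_nonneg _).trans (h82 0); rw [norm_zero] at h; norm_num at h; exact h
  have hU1 : ContDiff ℝ 1 U := hU.of_le one_le_two
  have hP1' : ContDiff ℝ 1 P := hP.of_le one_le_two
  have h0 : ∀ y, ‖U y‖ ≤ C₀ := fun y =>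
    (h19 y).trans (div_le_self hC0 (by linarith [norm_nonneg y]))
  have h1 : ∀ y, ‖fderiv ℝ U y‖ ≤ C₁ := fun y =>
    (h21 y).trans (div_le_self hC1 (by nlinarith [norm_nonneg y]))
  -- the `−(U·∇)U − ∇P` part: (6.11)
  have h611 := pineauVicol_6_11 hU hP h19 h21 hs h22 hPois hP1 hε
  -- continuity and growth of `A = −(U·∇)U − ∇P`, bound of `F`
  have cA : Continuous fun x => -(convect U U x) - gradient P x := by
    have c1 : Continuous (convect U U) := by
      have : convect U U = fun x => fderiv ℝ U x (U x) := by funext x; rfl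
      rw [this]; exact (hU1.continuous_fderiv one_ne_zero).clm_apply hU.continuous
    exact c1.neg.sub ((InnerProductSpace.toDual ℝ (EuclideanSpace ℝ (Fin 3))).symm.continuous.comp
      (hP1'.continuous_fderiv one_ne_zero))
  have hone : ∀ y : EuclideanSpace ℝ (Fin 3), (1 : ℝ) ≤ (1 + ‖y‖) ^ N := fun y =>
    one_le_pow₀ (by linarith [norm_nonneg y])
  have bA : ∀ y, ‖-(convect U U y) - gradient P y‖ ≤ (C₀ * C₁ + C) * (1 + ‖y‖) ^ N := fun y => by
    have hc : ‖convect U U y‖ ≤ C₁ * C₀ := by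
      rw [convect_apply]
      exact (ContinuousLinearMap.le_opNorm _ _).trans (mul_le_mul (h1 y) (h0 y) (norm_nonneg _) hC1)
    calc ‖-(convect U U y) - gradient P y‖ ≤ ‖-(convect U U y)‖ + ‖gradient P y‖ := norm_sub_le _ _
      _ ≤ C₁ * C₀ + C * (1 + ‖y‖) ^ N := by rw [norm_neg]; exact add_le_add hc (hP1 y)
      _ ≤ (C₀ * C₁ + C) * (1 + ‖y‖) ^ N := by nlinarith [hone y, mul_nonneg hC0 hC1]
  have bF : ∀ y, ‖F y‖ ≤ Cs * Sper * (1 + |α|) ^ 2 := fun y =>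
    (h82 y).trans (div_le_self hm (by linarith [norm_nonneg y]))
  have hsub := sqrt_integral_gaussWeight_angularFluctVec_sub_le cA hF bA bF
  linarith [hsub, h611]

/-- **Pineau–Vicol 2026, Lemma 8.2, as printed (p. 28).** "Assume that the smooth incompressible
vector field `U : ℝ³ × [0, S] → ℝ³` satisfies the bounds (8.3). Define `𝓝 := −(U·∇)U − ∇P − ∂_sU`
(8.4), where `P = RᵢRⱼ(UᵢUⱼ)` … For any `ε ∈ (0,1]`, there exist constants
`C_ε = C_ε(ε, C_{U,0}) > 0` and `δ_ε = δ(ε, C_{U,0}) > 0` such that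
`‖(𝓝)_a‖_{L²_μ} ≤ ε + C_ε‖(U)_a‖_{L²_μ} + C_ε‖∇(U)_a‖_{L²_μ}` (8.5), holds uniformly for all
`s ∈ [0, S]`, provided that `S(1 + |α|)² ≤ δ_ε`." Rendering: on each time slice (`F = ∂_sU(·,s)`
with the first bound of (8.2)); `C_ε, δ_ε` chosen from `(ε, C_{U,0}, C_{U,1}, C_{U,s})` before
`U, P, F, α, S`; class as in `pineauVicol_8_5`; any `ε > 0`. [cite: PineauVicol2026, Lemma 8.2 (p. 28)] -/
theorem pineauVicol_lemma_8_2 (C₀ C₁ CP s Cs : ℝ) (hs : 3 / 2 < s) {ε : ℝ} (hε : 0 < ε) :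
    ∃ Cε : ℝ, 0 < Cε ∧ ∃ δ : ℝ, 0 < δ ∧
      ∀ (U F : EuclideanSpace ℝ (Fin 3) → EuclideanSpace ℝ (Fin 3)) (P : EuclideanSpace ℝ (Fin 3) → ℝ)
        (α Sper : ℝ), ContDiff ℝ 2 U → ContDiff ℝ 2 P →
        (∀ y, ‖U y‖ ≤ C₀ / (1 + ‖y‖)) → (∀ y, ‖fderiv ℝ U y‖ ≤ C₁ / (1 + ‖y‖ ^ 2)) →
        (∀ y, |P y| ≤ CP / (1 + ‖y‖ ^ s)) →
        (∀ y, Δ P y = -VectorCalculus.divergence (convect U U) y) →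
        Continuous F → 0 ≤ Sper → (∀ y, ‖F y‖ ≤ Cs * Sper * (1 + |α|) ^ 2 / (1 + ‖y‖)) →
        Sper * (1 + |α|) ^ 2 ≤ δ →
        ∀ (C : ℝ) (N : ℕ), (∀ y, ‖gradient P y‖ ≤ C * (1 + ‖y‖) ^ N) →
          Real.sqrt (∫ y, gaussWeight y *
              ‖angularFluctVec (fun x => -(convect U U x) - gradient P x - F x) y‖ ^ 2) ≤
            ε + Cε * Real.sqrt (∫ y, gaussWeight y * ‖angularFluctVec U y‖ ^ 2) +
              Cε * Real.sqrt (∫ y, gaussWeight y *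
                ∑ i, ‖fderiv ℝ (angularFluctVec U) y (EuclideanSpace.basisFun (Fin 3) ℝ i)‖ ^ 2) := by
  set E := Real.exp ((max 1 ((24 * (C₀ * C₁) / (ε / 2)) ^ ((2 : ℝ) / 3))) ^ 2 / 8) with hE
  set G := Real.sqrt (∫ y : EuclideanSpace ℝ (Fin 3), gaussWeight y) with hG
  have hG0 : 0 ≤ G := Real.sqrt_nonneg _
  refine ⟨(1 + 9 * E) * (|C₁| + 3 * |C₀|) + 1, by positivity,
    ε / (2 * (|Cs| + 1) * (G + 1)), by positivity, ?_⟩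
  intro U F P α Sper hU hP h19 h21 h22 hPois hF hSper h82 hsmall C N hP1
  have hC0 : 0 ≤ C₀ := by
    have h := (norm_nonneg _).trans (h19 0); rw [norm_zero] at h; norm_num at h; exact h
  have hC1 : 0 ≤ C₁ := by
    have h := (norm_nonneg _).trans (h21 0); rw [norm_zero] at h; norm_num at h; exact h
  have hε2 : 0 < ε / 2 := by positivity
  have h := pineauVicol_8_5 hU hP h19 h21 hs h22 hPois hP1 hF h82 hε2
  rw [← hE, ← hG] at h
  rw [abs_of_nonneg hC0, abs_of_nonneg hC1]
  have hUa : 0 ≤ Real.sqrt (∫ y, gaussWeight y * ‖angularFluctVec U y‖ ^ 2) := Real.sqrt_nonneg _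
  have hGa : 0 ≤ Real.sqrt (∫ y, gaussWeight y *
      ∑ i, ‖fderiv ℝ (angularFluctVec U) y (EuclideanSpace.basisFun (Fin 3) ℝ i)‖ ^ 2) :=
    Real.sqrt_nonneg _
  -- the slice term is `≤ ε/2`
  have ht : 0 ≤ Sper * (1 + |α|) ^ 2 := by positivity
  have hslice : Cs * Sper * (1 + |α|) ^ 2 * G ≤ ε / 2 := by
    have h1 : Cs * Sper * (1 + |α|) ^ 2 * G ≤ |Cs| * (Sper * (1 + |α|) ^ 2) * G := by
      have := mul_le_mul_of_nonneg_right (le_abs_self Cs) ht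
      nlinarith [hG0]
    have h2 : |Cs| * (Sper * (1 + |α|) ^ 2) * G ≤ |Cs| * (ε / (2 * (|Cs| + 1) * (G + 1))) * G :=
      mul_le_mul_of_nonneg_right (mul_le_mul_of_nonneg_left hsmall (abs_nonneg _)) hG0
    have h3 : |Cs| * (ε / (2 * (|Cs| + 1) * (G + 1))) * G ≤ ε / 2 := by
      rw [show |Cs| * (ε / (2 * (|Cs| + 1) * (G + 1))) * G =
          ε / 2 * ((|Cs| / (|Cs| + 1)) * (G / (G + 1))) by field_simp]
      have a1 : |Cs| / (|Cs| + 1) ≤ 1 := by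
        rw [div_le_one (by positivity)]; linarith [abs_nonneg Cs]
      have a2 : G / (G + 1) ≤ 1 := by rw [div_le_one (by positivity)]; linarith
      have a3 : 0 ≤ |Cs| / (|Cs| + 1) := by positivity
      have a4 : 0 ≤ G / (G + 1) := by positivity
      nlinarith [mul_le_mul a1 a2 a4 zero_le_one]
    linarith
  nlinarith [hUa, hGa, hslice, h]

/-! ### (8.6) and Proposition 8.3 on a time slice -/

/-- **Pineau–Vicol 2026, Proposition 8.3 (8.6) on a time slice, explicit thresholds**: for
`U, P ∈ C²` and a continuous `F` (`= ∂_sU(·, s)`) with the slice profile equation (1.14a)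
`α𝓡U + ½U + ½(y·∇)U − ΔU + (U·∇)U + ∇P + F = 0` pointwise, in the class of `pineauVicol_8_5`
(with both halves of (2.1)): if `|α| ≥ (27/2)C²` with `C` the (6.11)-constant at level `ε/12`
and the slice term satisfies `C_{U,s}S(1+|α|)²(∫γ)^{1/2} ≤ ε/12`, then `|α| ‖𝓡U‖_{L²_μ} ≤ ε`
("by arguing exactly as in the proof of Proposition 6.5": (8.5) at level `ε/6` in
`pineauVicol_prop_6_5_of_source`). [cite: PineauVicol2026, Proposition 8.3 (8.6) (p. 28)] -/
theorem pineauVicol_8_6 {U F : EuclideanSpace ℝ (Fin 3) → EuclideanSpace ℝ (Fin 3)}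
    {P : EuclideanSpace ℝ (Fin 3) → ℝ} {α : ℝ} (hU : ContDiff ℝ 2 U) (hP : ContDiff ℝ 2 P)
    {C₀ C₁ C₂ CP s : ℝ}
    (h19 : ∀ y, ‖U y‖ ≤ C₀ / (1 + ‖y‖)) (h21 : ∀ y, ‖fderiv ℝ U y‖ ≤ C₁ / (1 + ‖y‖ ^ 2))
    (h21' : ∀ y, ‖fderiv ℝ (fderiv ℝ U) y‖ ≤ C₂ / (1 + ‖y‖ ^ 3))
    (hs : 3 / 2 < s) (h22 : ∀ y, |P y| ≤ CP / (1 + ‖y‖ ^ s))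
    (hPois : ∀ y, Δ P y = -VectorCalculus.divergence (convect U U) y)
    {C : ℝ} {N : ℕ} (hP1 : ∀ y, ‖gradient P y‖ ≤ C * (1 + ‖y‖) ^ N)
    (hF : Continuous F) {Cs Sper : ℝ}
    (h82 : ∀ y, ‖F y‖ ≤ Cs * Sper * (1 + |α|) ^ 2 / (1 + ‖y‖))
    (heq : ∀ y, α • (rotGen (U y) - fderiv ℝ U y (rotGen y)) + (1 / 2 : ℝ) • U y +
      (1 / 2 : ℝ) • fderiv ℝ U y y - (Δ U) y + convect U U y + gradient P y + F y = 0)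
    {ε : ℝ} (hε : 0 < ε)
    (hsmall : Cs * Sper * (1 + |α|) ^ 2 * Real.sqrt (∫ y : EuclideanSpace ℝ (Fin 3), gaussWeight y) ≤ ε / 12)
    (hα : 27 / 2 * ((1 + 9 * Real.exp ((max 1 ((24 * (C₀ * C₁) / (ε / 12)) ^ ((2 : ℝ) / 3))) ^ 2 / 8)) *
      (C₁ + 3 * C₀)) ^ 2 ≤ |α|) :
    |α| * Real.sqrt (∫ y, gaussWeight y * ‖rotGen (U y) - fderiv ℝ U y (rotGen y)‖ ^ 2) ≤ ε := by
  have hC0 : 0 ≤ C₀ := by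
    have h := (norm_nonneg _).trans (h19 0); rw [norm_zero] at h; norm_num at h; exact h
  have hC1 : 0 ≤ C₁ := by
    have h := (norm_nonneg _).trans (h21 0); rw [norm_zero] at h; norm_num at h; exact h
  have hm : 0 ≤ Cs * Sper * (1 + |α|) ^ 2 := by
    have h := (norm_nonneg _).trans (h82 0); rw [norm_zero] at h; norm_num at h; exact h
  have hU1 : ContDiff ℝ 1 U := hU.of_le one_le_two
  have hP1' : ContDiff ℝ 1 P := hP.of_le one_le_two
  -- the source `𝓢 = −(U·∇)U − ∇P − F` and its equation
  have heqS : ∀ y, α • (rotGen (U y) - fderiv ℝ U y (rotGen y)) + (1 / 2 : ℝ) • U y +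
      (1 / 2 : ℝ) • fderiv ℝ U y y - (Δ U) y = -(convect U U y) - gradient P y - F y := by
    intro y
    rw [← sub_eq_zero]
    have : α • (rotGen (U y) - fderiv ℝ U y (rotGen y)) + (1 / 2 : ℝ) • U y +
        (1 / 2 : ℝ) • fderiv ℝ U y y - (Δ U) y - (-(convect U U y) - gradient P y - F y) =
        α • (rotGen (U y) - fderiv ℝ U y (rotGen y)) + (1 / 2 : ℝ) • U y +
        (1 / 2 : ℝ) • fderiv ℝ U y y - (Δ U) y + convect U U y + gradient P y + F y := by abel
    rw [this, heq y]
  have cS : Continuous fun x => -(convect U U x) - gradient P x - F x := by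
    have c1 : Continuous (convect U U) := by
      have : convect U U = fun x => fderiv ℝ U x (U x) := by funext x; rfl
      rw [this]; exact (hU1.continuous_fderiv one_ne_zero).clm_apply hU.continuous
    exact (c1.neg.sub ((InnerProductSpace.toDual ℝ (EuclideanSpace ℝ (Fin 3))).symm.continuous.comp
      (hP1'.continuous_fderiv one_ne_zero))).sub hF
  -- one growth constant
  set K := C₀ + C₁ + |C₂| + |C| + C₀ * C₁ + Cs * Sper * (1 + |α|) ^ 2 with hK
  have hK0 : 0 ≤ K := by positivity
  have hpow : ∀ y : EuclideanSpace ℝ (Fin 3), (1 : ℝ) ≤ (1 + ‖y‖) ^ N := fun y =>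
    one_le_pow₀ (by linarith [norm_nonneg y])
  have hKp : ∀ y : EuclideanSpace ℝ (Fin 3), K ≤ K * (1 + ‖y‖) ^ N := fun y =>
    le_mul_of_one_le_right hK0 (hpow y)
  have h0 : ∀ y, ‖U y‖ ≤ C₀ := fun y =>
    (h19 y).trans (div_le_self hC0 (by linarith [norm_nonneg y]))
  have h1 : ∀ y, ‖fderiv ℝ U y‖ ≤ C₁ := fun y =>
    (h21 y).trans (div_le_self hC1 (by nlinarith [norm_nonneg y]))
  have hU0 : ∀ y, ‖U y‖ ≤ K * (1 + ‖y‖) ^ N := fun y => by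
    have := h0 y
    have : C₀ ≤ K := by rw [hK]; nlinarith [abs_nonneg C₂, abs_nonneg C, mul_nonneg hC0 hC1]
    linarith [hKp y]
  have hU1b : ∀ y, ‖fderiv ℝ U y‖ ≤ K * (1 + ‖y‖) ^ N := fun y => by
    have := h1 y
    have : C₁ ≤ K := by rw [hK]; nlinarith [abs_nonneg C₂, abs_nonneg C, mul_nonneg hC0 hC1]
    linarith [hKp y]
  have hU2 : ∀ y, ‖fderiv ℝ (fderiv ℝ U) y‖ ≤ K * (1 + ‖y‖) ^ N := fun y => by
    have h := (h21' y).trans ((div_le_div_of_nonneg_right (le_abs_self C₂)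
      (by nlinarith [pow_nonneg (norm_nonneg y) 3])).trans
      (div_le_self (abs_nonneg C₂) (by nlinarith [pow_nonneg (norm_nonneg y) 3])))
    have : |C₂| ≤ K := by rw [hK]; nlinarith [abs_nonneg C, mul_nonneg hC0 hC1]
    linarith [hKp y]
  have hS0 : ∀ y, ‖-(convect U U y) - gradient P y - F y‖ ≤ K * (1 + ‖y‖) ^ N := fun y => by
    have hc : ‖convect U U y‖ ≤ C₁ * C₀ := by
      rw [convect_apply]
      exact (ContinuousLinearMap.le_opNorm _ _).trans (mul_le_mul (h1 y) (h0 y) (norm_nonneg _) hC1)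
    have hf : ‖F y‖ ≤ Cs * Sper * (1 + |α|) ^ 2 :=
      (h82 y).trans (div_le_self hm (by linarith [norm_nonneg y]))
    have hg : ‖gradient P y‖ ≤ |C| * (1 + ‖y‖) ^ N :=
      (hP1 y).trans (mul_le_mul_of_nonneg_right (le_abs_self C) (by positivity))
    calc ‖-(convect U U y) - gradient P y - F y‖
        ≤ ‖-(convect U U y)‖ + ‖gradient P y‖ + ‖F y‖ := norm_sub_le_of_le (norm_sub_le _ _) le_rfl
      _ ≤ C₁ * C₀ + |C| * (1 + ‖y‖) ^ N + Cs * Sper * (1 + |α|) ^ 2 := by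
          rw [norm_neg]; exact add_le_add (add_le_add hc hg) hf
      _ ≤ K * (1 + ‖y‖) ^ N := by
          rw [hK]
          nlinarith [hpow y, mul_nonneg hC0 hC1, abs_nonneg C₂, abs_nonneg C, hm,
            mul_nonneg (add_nonneg (add_nonneg (add_nonneg hC0 hC1) (abs_nonneg C₂))
              (add_nonneg (mul_nonneg hC0 hC1) hm)) (le_trans zero_le_one (hpow y))]
  -- (8.5) at level `ε/12`, slice term `≤ ε/12`
  have hε12 : 0 < ε / 12 := by positivity
  have h85 := pineauVicol_8_5 hU hP h19 h21 hs h22 hPois hP1 hF h82 hε12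
  have hUa : 0 ≤ Real.sqrt (∫ y, gaussWeight y * ‖angularFluctVec U y‖ ^ 2) := Real.sqrt_nonneg _
  have hGa : 0 ≤ Real.sqrt (∫ y, gaussWeight y *
      ∑ i, ‖fderiv ℝ (angularFluctVec U) y (EuclideanSpace.basisFun (Fin 3) ℝ i)‖ ^ 2) :=
    Real.sqrt_nonneg _
  have h611 : Real.sqrt (∫ y, gaussWeight y *
      ‖angularFluctVec (fun x => -(convect U U x) - gradient P x - F x) y‖ ^ 2) ≤
      ε / 6 + (1 + 9 * Real.exp ((max 1 ((24 * (C₀ * C₁) / (ε / 12)) ^ ((2 : ℝ) / 3))) ^ 2 / 8)) *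
          (C₁ + 3 * C₀) * Real.sqrt (∫ y, gaussWeight y * ‖angularFluctVec U y‖ ^ 2) +
        (1 + 9 * Real.exp ((max 1 ((24 * (C₀ * C₁) / (ε / 12)) ^ ((2 : ℝ) / 3))) ^ 2 / 8)) *
          (C₁ + 3 * C₀) * Real.sqrt (∫ y, gaussWeight y *
            ∑ i, ‖fderiv ℝ (angularFluctVec U) y (EuclideanSpace.basisFun (Fin 3) ℝ i)‖ ^ 2) := by
    linarith [h85, hsmall]
  exact pineauVicol_prop_6_5_of_source hU hU0 hU1b hU2 cS hS0 heqS hε.le h611 hα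

/-- **Pineau–Vicol 2026, Proposition 8.3, as printed (p. 28).** "Suppose that the profiles `(U, P)`
satisfy the bounds (8.3). For any `ε ∈ (0,1]`, there exist constants `A_ε = A(ε, C_{U,0}) ≥ 1` and
`δ_ε = δ(ε, C_{U,0})`, such that for all `|α| ≥ A_ε`, if `S(1 + |α|)² ≤ δ_ε` we have
`|α| ‖𝓡U‖_{L²_μ} ≤ ε` (8.6), uniformly for all `s ∈ [0, S]`." Rendering: on each time slice, with
`A_ε ≥ 1`, `δ_ε > 0` chosen from `(ε, C_{U,0}, C_{U,1}, C_{U,s})` before `U, P, F, α, S`; the class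
is that of `pineauVicol_8_6`; any `ε > 0`. [cite: PineauVicol2026, Proposition 8.3 (8.6) (p. 28)] -/
theorem pineauVicol_prop_8_3 (C₀ C₁ C₂ CP s Cs : ℝ) (hs : 3 / 2 < s) {ε : ℝ} (hε : 0 < ε) :
    ∃ A : ℝ, 1 ≤ A ∧ ∃ δ : ℝ, 0 < δ ∧
      ∀ (U F : EuclideanSpace ℝ (Fin 3) → EuclideanSpace ℝ (Fin 3)) (P : EuclideanSpace ℝ (Fin 3) → ℝ)
        (α Sper : ℝ), ContDiff ℝ 2 U → ContDiff ℝ 2 P →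
        (∀ y, ‖U y‖ ≤ C₀ / (1 + ‖y‖)) → (∀ y, ‖fderiv ℝ U y‖ ≤ C₁ / (1 + ‖y‖ ^ 2)) →
        (∀ y, ‖fderiv ℝ (fderiv ℝ U) y‖ ≤ C₂ / (1 + ‖y‖ ^ 3)) →
        (∀ y, |P y| ≤ CP / (1 + ‖y‖ ^ s)) →
        (∀ y, Δ P y = -VectorCalculus.divergence (convect U U) y) →
        Continuous F → 0 ≤ Sper → (∀ y, ‖F y‖ ≤ Cs * Sper * (1 + |α|) ^ 2 / (1 + ‖y‖)) →
        (∀ y, α • (rotGen (U y) - fderiv ℝ U y (rotGen y)) + (1 / 2 : ℝ) • U y +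
          (1 / 2 : ℝ) • fderiv ℝ U y y - (Δ U) y + convect U U y + gradient P y + F y = 0) →
        ∀ (C : ℝ) (N : ℕ), (∀ y, ‖gradient P y‖ ≤ C * (1 + ‖y‖) ^ N) →
          A ≤ |α| → Sper * (1 + |α|) ^ 2 ≤ δ →
            |α| * Real.sqrt (∫ y, gaussWeight y * ‖rotGen (U y) - fderiv ℝ U y (rotGen y)‖ ^ 2) ≤ ε := by
  set G := Real.sqrt (∫ y : EuclideanSpace ℝ (Fin 3), gaussWeight y) with hG
  have hG0 : 0 ≤ G := Real.sqrt_nonneg _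
  refine ⟨max 1 (27 / 2 * ((1 + 9 * Real.exp ((max 1 ((24 * (C₀ * C₁) / (ε / 12)) ^ ((2 : ℝ) / 3))) ^ 2 / 8)) *
      (C₁ + 3 * C₀)) ^ 2), le_max_left _ _, ε / (12 * (|Cs| + 1) * (G + 1)), by positivity, ?_⟩
  intro U F P α Sper hU hP h19 h21 h21' h22 hPois hF hSper h82 heq C N hP1 hA hsmall
  have ht : 0 ≤ Sper * (1 + |α|) ^ 2 := by positivity
  have hslice : Cs * Sper * (1 + |α|) ^ 2 * G ≤ ε / 12 := by
    have h1 : Cs * Sper * (1 + |α|) ^ 2 * G ≤ |Cs| * (Sper * (1 + |α|) ^ 2) * G := by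
      have := mul_le_mul_of_nonneg_right (le_abs_self Cs) ht
      nlinarith [hG0]
    have h2 : |Cs| * (Sper * (1 + |α|) ^ 2) * G ≤ |Cs| * (ε / (12 * (|Cs| + 1) * (G + 1))) * G :=
      mul_le_mul_of_nonneg_right (mul_le_mul_of_nonneg_left hsmall (abs_nonneg _)) hG0
    have h3 : |Cs| * (ε / (12 * (|Cs| + 1) * (G + 1))) * G ≤ ε / 12 := by
      rw [show |Cs| * (ε / (12 * (|Cs| + 1) * (G + 1))) * G =
          ε / 12 * ((|Cs| / (|Cs| + 1)) * (G / (G + 1))) by field_simp]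
      have a1 : |Cs| / (|Cs| + 1) ≤ 1 := by
        rw [div_le_one (by positivity)]; linarith [abs_nonneg Cs]
      have a2 : G / (G + 1) ≤ 1 := by rw [div_le_one (by positivity)]; linarith
      have a3 : 0 ≤ |Cs| / (|Cs| + 1) := by positivity
      have a4 : 0 ≤ G / (G + 1) := by positivity
      nlinarith [mul_le_mul a1 a2 a4 zero_le_one]
    linarith
  rw [hG] at hslice
  exact pineauVicol_8_6 hU hP h19 h21 h21' hs h22 hPois hP1 hF h82 heq hε hslice
    ((le_max_right _ _).trans hA)

/-! ### Proposition 8.3 with hypotheses on the profile slice only: the growth of `∇P` from (1.14a) -/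

/-- The second partial `∂ᵥ∂ₑU` as the second derivative: `D(z ↦ DU(z)[e])(x)[v] = D²U(x)[v][e]`.
[folklore] -/
private theorem fderiv_fderiv_apply_eq_aux' {U : EuclideanSpace ℝ (Fin 3) → EuclideanSpace ℝ (Fin 3)}
    (hU : ContDiff ℝ 2 U) (x e v : EuclideanSpace ℝ (Fin 3)) :
    fderiv ℝ (fun z => fderiv ℝ U z e) x v = fderiv ℝ (fderiv ℝ U) x v e := by
  have hd : DifferentiableAt ℝ (fderiv ℝ U) x :=
    ((hU.fderiv_right (m := 1) le_rfl).differentiable one_ne_zero) x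
  rw [fderiv_clm_apply hd (differentiableAt_const e)]
  simp

/-- `|ΔU(x)| ≤ 3 ‖D²U(x)‖` on `ℝ³` (the Laplacian is the trace of the Hessian). [folklore] -/
private theorem norm_laplacian_le_three_mul_aux' {U : EuclideanSpace ℝ (Fin 3) → EuclideanSpace ℝ (Fin 3)}
    (hU : ContDiff ℝ 2 U) (x : EuclideanSpace ℝ (Fin 3)) :
    ‖(Δ U) x‖ ≤ 3 * ‖fderiv ℝ (fderiv ℝ U) x‖ := by
  have h1 : ∀ i, ‖EuclideanSpace.basisFun (Fin 3) ℝ i‖ = 1 :=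
    (EuclideanSpace.basisFun (Fin 3) ℝ).orthonormal.1
  rw [laplacian_eq_sum_fderiv_fderiv (EuclideanSpace.basisFun (Fin 3) ℝ) hU x]
  calc ‖∑ i, fderiv ℝ (fun z => fderiv ℝ U z (EuclideanSpace.basisFun (Fin 3) ℝ i)) x
        (EuclideanSpace.basisFun (Fin 3) ℝ i)‖
      ≤ ∑ i, ‖fderiv ℝ (fun z => fderiv ℝ U z (EuclideanSpace.basisFun (Fin 3) ℝ i)) x
        (EuclideanSpace.basisFun (Fin 3) ℝ i)‖ := norm_sum_le _ _
    _ ≤ ∑ _i : Fin 3, ‖fderiv ℝ (fderiv ℝ U) x‖ := Finset.sum_le_sum fun i _ => by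
        rw [fderiv_fderiv_apply_eq_aux' hU]
        calc ‖fderiv ℝ (fderiv ℝ U) x (EuclideanSpace.basisFun (Fin 3) ℝ i)
              (EuclideanSpace.basisFun (Fin 3) ℝ i)‖
            ≤ ‖fderiv ℝ (fderiv ℝ U) x (EuclideanSpace.basisFun (Fin 3) ℝ i)‖ *
                ‖EuclideanSpace.basisFun (Fin 3) ℝ i‖ := ContinuousLinearMap.le_opNorm _ _
          _ ≤ (‖fderiv ℝ (fderiv ℝ U) x‖ * ‖EuclideanSpace.basisFun (Fin 3) ℝ i‖) *
                ‖EuclideanSpace.basisFun (Fin 3) ℝ i‖ :=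
              mul_le_mul_of_nonneg_right (ContinuousLinearMap.le_opNorm _ _) (norm_nonneg _)
          _ = ‖fderiv ℝ (fderiv ℝ U) x‖ := by rw [h1 i, mul_one, mul_one]
    _ = 3 * ‖fderiv ℝ (fderiv ℝ U) x‖ := by rw [Fin.sum_univ_three]; ring

/-- The five terms of (1.14a)/(6.16a) other than `∇P` and `∂_sU` grow at most linearly:
`|α𝓡U + ½U + ½(y·∇)U − ΔU + (U·∇)U|(y) ≤ (|α|(C₀ + C₁) + C₀ + C₁ + 3C₂ + C₀C₁)(1 + |y|)` when
`|U| ≤ C₀`, `|DU| ≤ C₁`, `|D²U| ≤ C₂` (`|𝓡U| ≤ |U| + |DU| |Jy|`, `|Jy| ≤ |y|`, `|ΔU| ≤ 3|D²U|`).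
[folklore] -/
private theorem norm_profileTerms_le {U : EuclideanSpace ℝ (Fin 3) → EuclideanSpace ℝ (Fin 3)} {α : ℝ}
    (hU : ContDiff ℝ 2 U) {C₀ C₁ C₂ : ℝ} (h0 : ∀ y, ‖U y‖ ≤ C₀) (h1 : ∀ y, ‖fderiv ℝ U y‖ ≤ C₁)
    (h2 : ∀ y, ‖fderiv ℝ (fderiv ℝ U) y‖ ≤ C₂) (y : EuclideanSpace ℝ (Fin 3)) :
    ‖α • (rotGen (U y) - fderiv ℝ U y (rotGen y)) + (1 / 2 : ℝ) • U y +
        (1 / 2 : ℝ) • fderiv ℝ U y y - (Δ U) y + convect U U y‖ ≤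
      (|α| * (C₀ + C₁) + C₀ + C₁ + 3 * C₂ + C₀ * C₁) * (1 + ‖y‖) := by
  have hy : 0 ≤ ‖y‖ := norm_nonneg y
  have ha : 0 ≤ |α| := abs_nonneg α
  have hC0 : 0 ≤ C₀ := (norm_nonneg _).trans (h0 0)
  have hC1 : 0 ≤ C₁ := (norm_nonneg _).trans (h1 0)
  have hL : ‖(Δ U) y‖ ≤ 3 * C₂ :=
    (norm_laplacian_le_three_mul_aux' hU y).trans (mul_le_mul_of_nonneg_left (h2 y) (by norm_num))
  have hC2 : 0 ≤ C₂ := by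
    have h := (norm_nonneg ((Δ U) 0)).trans ((norm_laplacian_le_three_mul_aux' hU 0).trans
      (mul_le_mul_of_nonneg_left (h2 0) (by norm_num)))
    linarith
  have na : ‖α • (rotGen (U y) - fderiv ℝ U y (rotGen y))‖ ≤ |α| * (C₀ + C₁ * ‖y‖) := by
    rw [norm_smul, Real.norm_eq_abs]
    refine mul_le_mul_of_nonneg_left ?_ ha
    calc ‖rotGen (U y) - fderiv ℝ U y (rotGen y)‖ ≤ ‖rotGen (U y)‖ + ‖fderiv ℝ U y (rotGen y)‖ :=
          norm_sub_le _ _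
      _ ≤ C₀ + C₁ * ‖y‖ := add_le_add ((norm_rotGen_le _).trans (h0 y))
          ((ContinuousLinearMap.le_opNorm _ _).trans
            (mul_le_mul (h1 y) (norm_rotGen_le y) (norm_nonneg _) hC1))
  have nb : ‖(1 / 2 : ℝ) • U y‖ ≤ 1 / 2 * C₀ := by
    rw [norm_smul, Real.norm_of_nonneg (by norm_num : (0 : ℝ) ≤ 1 / 2)]
    exact mul_le_mul_of_nonneg_left (h0 y) (by norm_num)
  have nc : ‖(1 / 2 : ℝ) • fderiv ℝ U y y‖ ≤ 1 / 2 * (C₁ * ‖y‖) := by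
    rw [norm_smul, Real.norm_of_nonneg (by norm_num : (0 : ℝ) ≤ 1 / 2)]
    exact mul_le_mul_of_nonneg_left
      ((ContinuousLinearMap.le_opNorm _ _).trans (mul_le_mul_of_nonneg_right (h1 y) hy)) (by norm_num)
  have ne : ‖convect U U y‖ ≤ C₁ * C₀ := by
    rw [convect_apply]
    exact (ContinuousLinearMap.le_opNorm _ _).trans (mul_le_mul (h1 y) (h0 y) (norm_nonneg _) hC1)
  have hsum : ∀ a b c d e : EuclideanSpace ℝ (Fin 3),
      ‖a + b + c - d + e‖ ≤ ‖a‖ + ‖b‖ + ‖c‖ + ‖d‖ + ‖e‖ := by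
    intro a b c d e
    have h₁ := norm_add_le (a + b + c - d) e
    have h₂ := norm_sub_le (a + b + c) d
    have h₃ := norm_add_le (a + b) c
    have h₄ := norm_add_le a b
    linarith
  have h5 := hsum (α • (rotGen (U y) - fderiv ℝ U y (rotGen y))) ((1 / 2 : ℝ) • U y)
    ((1 / 2 : ℝ) • fderiv ℝ U y y) ((Δ U) y) (convect U U y)
  linarith [mul_nonneg ha hC1, mul_nonneg (mul_nonneg ha hC0) hy, mul_nonneg hC0 hy,
    mul_nonneg hC1 hy, mul_nonneg hC2 hy, mul_nonneg (mul_nonneg hC0 hC1) hy]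

/-- **The growth of `∇P` is a consequence of the slice equation (1.14a)**: for a `C²` slice with
`|U| ≤ C₀`, `|DU| ≤ C₁`, `|D²U| ≤ C₂`, `|∂_sU| ≤ m` solving
`∂_sU + α𝓡U + ½U + ½(y·∇)U − ΔU + (U·∇)U + ∇P = 0`,
`|∇P(y)| ≤ (|α|(C₀ + C₁) + C₀ + C₁ + 3C₂ + C₀C₁ + m)(1 + |y|)`.
[cite: PineauVicol2026, (1.14a) (p. 7) with (8.2)–(8.3) (p. 28)] -/
theorem norm_gradient_le_of_slice_equation
    {U F : EuclideanSpace ℝ (Fin 3) → EuclideanSpace ℝ (Fin 3)} {P : EuclideanSpace ℝ (Fin 3) → ℝ} {α : ℝ}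
    (hU : ContDiff ℝ 2 U) {C₀ C₁ C₂ m : ℝ} (h0 : ∀ y, ‖U y‖ ≤ C₀) (h1 : ∀ y, ‖fderiv ℝ U y‖ ≤ C₁)
    (h2 : ∀ y, ‖fderiv ℝ (fderiv ℝ U) y‖ ≤ C₂) (hFm : ∀ y, ‖F y‖ ≤ m)
    (heq : ∀ y, α • (rotGen (U y) - fderiv ℝ U y (rotGen y)) + (1 / 2 : ℝ) • U y +
      (1 / 2 : ℝ) • fderiv ℝ U y y - (Δ U) y + convect U U y + gradient P y + F y = 0)
    (y : EuclideanSpace ℝ (Fin 3)) :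
    ‖gradient P y‖ ≤ (|α| * (C₀ + C₁) + C₀ + C₁ + 3 * C₂ + C₀ * C₁ + m) * (1 + ‖y‖) ^ 1 := by
  have hy : 0 ≤ ‖y‖ := norm_nonneg y
  have hm : 0 ≤ m := (norm_nonneg _).trans (hFm 0)
  have hT := norm_profileTerms_le (α := α) hU h0 h1 h2 y
  have hg : gradient P y = -(α • (rotGen (U y) - fderiv ℝ U y (rotGen y)) + (1 / 2 : ℝ) • U y +
      (1 / 2 : ℝ) • fderiv ℝ U y y - (Δ U) y + convect U U y + F y) := by
    rw [eq_neg_iff_add_eq_zero, ← heq y]; abel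
  rw [hg, norm_neg, pow_one]
  refine (norm_add_le _ _).trans ?_
  have hF := hFm y
  nlinarith [mul_nonneg hm hy]

/-- From the decay (1.9), (2.1) (= (8.3), `k ≤ 2`): uniform bounds. [folklore] -/
private theorem uniform_bounds_of_decay {U : EuclideanSpace ℝ (Fin 3) → EuclideanSpace ℝ (Fin 3)}
    {C₀ C₁ C₂ : ℝ} (h19 : ∀ y, ‖U y‖ ≤ C₀ / (1 + ‖y‖))
    (h21 : ∀ y, ‖fderiv ℝ U y‖ ≤ C₁ / (1 + ‖y‖ ^ 2))
    (h21' : ∀ y, ‖fderiv ℝ (fderiv ℝ U) y‖ ≤ C₂ / (1 + ‖y‖ ^ 3)) :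
    (∀ y, ‖U y‖ ≤ C₀) ∧ (∀ y, ‖fderiv ℝ U y‖ ≤ C₁) ∧
      (∀ y, ‖fderiv ℝ (fderiv ℝ U) y‖ ≤ |C₂|) := by
  have hC0 : 0 ≤ C₀ := by
    have h := (norm_nonneg _).trans (h19 0); rw [norm_zero] at h; norm_num at h; exact h
  have hC1 : 0 ≤ C₁ := by
    have h := (norm_nonneg _).trans (h21 0); rw [norm_zero] at h; norm_num at h; exact h
  refine ⟨fun y => (h19 y).trans (div_le_self hC0 (by linarith [norm_nonneg y])),
    fun y => (h21 y).trans (div_le_self hC1 (by nlinarith [norm_nonneg y])), fun y => ?_⟩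
  exact (h21' y).trans ((div_le_div_of_nonneg_right (le_abs_self C₂)
    (by nlinarith [pow_nonneg (norm_nonneg y) 3])).trans
    (div_le_self (abs_nonneg C₂) (by nlinarith [pow_nonneg (norm_nonneg y) 3])))

/-- The first bound of (8.2) gives the uniform bound `|∂_sU| ≤ |C_{U,s} S| (1 + |α|)²`. [folklore] -/
private theorem norm_le_of_slice_bound {F : EuclideanSpace ℝ (Fin 3) → EuclideanSpace ℝ (Fin 3)}
    {α Cs Sper : ℝ} (h82 : ∀ y, ‖F y‖ ≤ Cs * Sper * (1 + |α|) ^ 2 / (1 + ‖y‖))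
    (y : EuclideanSpace ℝ (Fin 3)) : ‖F y‖ ≤ |Cs * Sper| * (1 + |α|) ^ 2 := by
  have hy : (1 : ℝ) ≤ 1 + ‖y‖ := by linarith [norm_nonneg y]
  have hnum : Cs * Sper * (1 + |α|) ^ 2 ≤ |Cs * Sper| * (1 + |α|) ^ 2 :=
    mul_le_mul_of_nonneg_right (le_abs_self _) (by positivity)
  exact (h82 y).trans ((div_le_div_of_nonneg_right hnum (by positivity)).trans
    (div_le_self (by positivity) hy))

/-- **Pineau–Vicol 2026, Proposition 8.3 (8.6) on a slice, with the printed hypotheses on the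
profile only** (Lemma 8.1's (8.2)–(8.3)): as `pineauVicol_8_6`, but the polynomial growth of `∇P`
is read off the slice equation (1.14a) (`norm_gradient_le_of_slice_equation`) instead of being
assumed. [cite: PineauVicol2026, Proposition 8.3 (8.6) (p. 28)] -/
theorem pineauVicol_8_6' {U F : EuclideanSpace ℝ (Fin 3) → EuclideanSpace ℝ (Fin 3)}
    {P : EuclideanSpace ℝ (Fin 3) → ℝ} {α : ℝ} (hU : ContDiff ℝ 2 U) (hP : ContDiff ℝ 2 P)
    {C₀ C₁ C₂ CP s : ℝ}
    (h19 : ∀ y, ‖U y‖ ≤ C₀ / (1 + ‖y‖)) (h21 : ∀ y, ‖fderiv ℝ U y‖ ≤ C₁ / (1 + ‖y‖ ^ 2))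
    (h21' : ∀ y, ‖fderiv ℝ (fderiv ℝ U) y‖ ≤ C₂ / (1 + ‖y‖ ^ 3))
    (hs : 3 / 2 < s) (h22 : ∀ y, |P y| ≤ CP / (1 + ‖y‖ ^ s))
    (hPois : ∀ y, Δ P y = -VectorCalculus.divergence (convect U U) y)
    (hF : Continuous F) {Cs Sper : ℝ}
    (h82 : ∀ y, ‖F y‖ ≤ Cs * Sper * (1 + |α|) ^ 2 / (1 + ‖y‖))
    (heq : ∀ y, α • (rotGen (U y) - fderiv ℝ U y (rotGen y)) + (1 / 2 : ℝ) • U y +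
      (1 / 2 : ℝ) • fderiv ℝ U y y - (Δ U) y + convect U U y + gradient P y + F y = 0)
    {ε : ℝ} (hε : 0 < ε)
    (hsmall : Cs * Sper * (1 + |α|) ^ 2 * Real.sqrt (∫ y : EuclideanSpace ℝ (Fin 3), gaussWeight y) ≤ ε / 12)
    (hα : 27 / 2 * ((1 + 9 * Real.exp ((max 1 ((24 * (C₀ * C₁) / (ε / 12)) ^ ((2 : ℝ) / 3))) ^ 2 / 8)) *
      (C₁ + 3 * C₀)) ^ 2 ≤ |α|) :
    |α| * Real.sqrt (∫ y, gaussWeight y * ‖rotGen (U y) - fderiv ℝ U y (rotGen y)‖ ^ 2) ≤ ε := by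
  obtain ⟨h0, h1, h2⟩ := uniform_bounds_of_decay h19 h21 h21'
  have hP1 := norm_gradient_le_of_slice_equation hU h0 h1 h2 (norm_le_of_slice_bound h82) heq
  exact pineauVicol_8_6 hU hP h19 h21 h21' hs h22 hPois hP1 hF h82 heq hε hsmall hα

/-- **Pineau–Vicol 2026, Proposition 8.3, as printed (p. 28), on a slice, hypotheses on the profile
only** — the `∃ A_ε ≥ 1 ∃ δ_ε > 0` form of `pineauVicol_8_6'`: as `pineauVicol_prop_8_3` without the
growth hypothesis on `∇P`. [cite: PineauVicol2026, Proposition 8.3 (8.6) (p. 28)] -/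
theorem pineauVicol_prop_8_3' (C₀ C₁ C₂ CP s Cs : ℝ) (hs : 3 / 2 < s) {ε : ℝ} (hε : 0 < ε) :
    ∃ A : ℝ, 1 ≤ A ∧ ∃ δ : ℝ, 0 < δ ∧
      ∀ (U F : EuclideanSpace ℝ (Fin 3) → EuclideanSpace ℝ (Fin 3)) (P : EuclideanSpace ℝ (Fin 3) → ℝ)
        (α Sper : ℝ), ContDiff ℝ 2 U → ContDiff ℝ 2 P →
        (∀ y, ‖U y‖ ≤ C₀ / (1 + ‖y‖)) → (∀ y, ‖fderiv ℝ U y‖ ≤ C₁ / (1 + ‖y‖ ^ 2)) →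
        (∀ y, ‖fderiv ℝ (fderiv ℝ U) y‖ ≤ C₂ / (1 + ‖y‖ ^ 3)) →
        (∀ y, |P y| ≤ CP / (1 + ‖y‖ ^ s)) →
        (∀ y, Δ P y = -VectorCalculus.divergence (convect U U) y) →
        Continuous F → 0 ≤ Sper → (∀ y, ‖F y‖ ≤ Cs * Sper * (1 + |α|) ^ 2 / (1 + ‖y‖)) →
        (∀ y, α • (rotGen (U y) - fderiv ℝ U y (rotGen y)) + (1 / 2 : ℝ) • U y +
          (1 / 2 : ℝ) • fderiv ℝ U y y - (Δ U) y + convect U U y + gradient P y + F y = 0) →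
          A ≤ |α| → Sper * (1 + |α|) ^ 2 ≤ δ →
            |α| * Real.sqrt (∫ y, gaussWeight y * ‖rotGen (U y) - fderiv ℝ U y (rotGen y)‖ ^ 2) ≤ ε := by
  obtain ⟨A, hA1, δ, hδ, h⟩ := pineauVicol_prop_8_3 C₀ C₁ C₂ CP s Cs hs hε
  refine ⟨A, hA1, δ, hδ, ?_⟩
  intro U F P α Sper hU hP h19 h21 h21' h22 hPois hF hSper h82 heq hA hsmall
  obtain ⟨h0, h1, h2⟩ := uniform_bounds_of_decay h19 h21 h21'
  exact h U F P α Sper hU hP h19 h21 h21' h22 hPois hF hSper h82 heq _ _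
    (norm_gradient_le_of_slice_equation hU h0 h1 h2 (norm_le_of_slice_bound h82) heq) hA hsmall


/-! ### Lemma 8.1, proof: the slice derivative read off (1.14a) (first display, `k = 0`) and the Poincaré-in-`s` step -/

/-- The five terms of (1.14a) other than `∇P` and `∂_sU` DECAY like `(1+|y|)⁻¹` under (8.3),
`k ≤ 2`: `(1+|y|) |α𝓡U + ½U + ½(y·∇)U − ΔU + (U·∇)U|(y) ≤ |α|(C₀ + 2C₁) + C₀/2 + C₁ + 6C₂ + C₀C₁`
when `|U| ≤ C₀/(1+|y|)`, `|DU| ≤ C₁/(1+|y|²)`, `|D²U| ≤ C₂/(1+|y|³)` (`|𝓡U| ≤ |U| + |DU| |y|`,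
`|y|(1+|y|) ≤ 2(1+|y|²)`, `1+|y| ≤ 2(1+|y|³)`, `|ΔU| ≤ 3|D²U|`). [folklore] -/
private theorem one_add_norm_mul_norm_profileTerms_le
    {U : EuclideanSpace ℝ (Fin 3) → EuclideanSpace ℝ (Fin 3)} {α : ℝ}
    (hU : ContDiff ℝ 2 U) {C₀ C₁ C₂ : ℝ} (h19 : ∀ y, ‖U y‖ ≤ C₀ / (1 + ‖y‖))
    (h21 : ∀ y, ‖fderiv ℝ U y‖ ≤ C₁ / (1 + ‖y‖ ^ 2))
    (h21' : ∀ y, ‖fderiv ℝ (fderiv ℝ U) y‖ ≤ C₂ / (1 + ‖y‖ ^ 3)) (y : EuclideanSpace ℝ (Fin 3)) :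
    (1 + ‖y‖) * ‖α • (rotGen (U y) - fderiv ℝ U y (rotGen y)) + (1 / 2 : ℝ) • U y +
        (1 / 2 : ℝ) • fderiv ℝ U y y - (Δ U) y + convect U U y‖ ≤
      |α| * (C₀ + 2 * C₁) + C₀ / 2 + C₁ + 6 * C₂ + C₀ * C₁ := by
  set r : ℝ := ‖y‖ with hr
  have hr0 : 0 ≤ r := norm_nonneg y
  have hw : 0 < 1 + r := by positivity
  have ha : 0 ≤ |α| := abs_nonneg α
  have hC0 : 0 ≤ C₀ := by
    have h := (norm_nonneg _).trans (h19 0); rw [norm_zero] at h; norm_num at h; exact h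
  have hC1 : 0 ≤ C₁ := by
    have h := (norm_nonneg _).trans (h21 0); rw [norm_zero] at h; norm_num at h; exact h
  have hC2 : 0 ≤ C₂ := by
    have h2 := h21' 0
    rw [norm_zero] at h2; norm_num at h2
    have hL0 : ‖(Δ U) 0‖ ≤ 3 * C₂ :=
      (norm_laplacian_le_three_mul_aux' hU 0).trans (mul_le_mul_of_nonneg_left h2 (by norm_num))
    have h0 := norm_nonneg ((Δ U) 0)
    linarith
  -- the weighted bounds
  have bU : (1 + r) * ‖U y‖ ≤ C₀ := by
    have h := h19 y; rw [← hr, le_div_iff₀ hw] at h; linarith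
  have bD : ‖fderiv ℝ U y‖ ≤ C₁ := (h21 y).trans (div_le_self hC1 (by nlinarith))
  have bDy : (1 + r) * (‖fderiv ℝ U y‖ * r) ≤ 2 * C₁ := by
    have h := h21 y
    rw [← hr] at h
    have h2 : 0 < 1 + r ^ 2 := by positivity
    have h3 : ‖fderiv ℝ U y‖ * (1 + r ^ 2) ≤ C₁ := by rwa [le_div_iff₀ h2] at h
    have h4 : (1 + r) * r ≤ 2 * (1 + r ^ 2) := by nlinarith [sq_nonneg (r - 1)]
    calc (1 + r) * (‖fderiv ℝ U y‖ * r) = ‖fderiv ℝ U y‖ * ((1 + r) * r) := by ring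
      _ ≤ ‖fderiv ℝ U y‖ * (2 * (1 + r ^ 2)) :=
          mul_le_mul_of_nonneg_left h4 (norm_nonneg _)
      _ = 2 * (‖fderiv ℝ U y‖ * (1 + r ^ 2)) := by ring
      _ ≤ 2 * C₁ := by linarith
  have bD2 : (1 + r) * ‖fderiv ℝ (fderiv ℝ U) y‖ ≤ 2 * C₂ := by
    have h := h21' y
    rw [← hr] at h
    have h2 : 0 < 1 + r ^ 3 := by positivity
    have h3 : ‖fderiv ℝ (fderiv ℝ U) y‖ * (1 + r ^ 3) ≤ C₂ := by rwa [le_div_iff₀ h2] at h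
    have h4 : (1 + r) ≤ 2 * (1 + r ^ 3) := by
      nlinarith [mul_nonneg hr0 (sq_nonneg (r - 1)), sq_nonneg (2 * r - 1)]
    have hn : 0 ≤ ‖fderiv ℝ (fderiv ℝ U) y‖ := by positivity
    calc (1 + r) * ‖fderiv ℝ (fderiv ℝ U) y‖ ≤ 2 * (1 + r ^ 3) * ‖fderiv ℝ (fderiv ℝ U) y‖ :=
          mul_le_mul_of_nonneg_right h4 hn
      _ = 2 * (‖fderiv ℝ (fderiv ℝ U) y‖ * (1 + r ^ 3)) := by ring
      _ ≤ 2 * C₂ := by linarith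
  -- the five terms
  have na : (1 + r) * ‖α • (rotGen (U y) - fderiv ℝ U y (rotGen y))‖ ≤ |α| * (C₀ + 2 * C₁) := by
    rw [norm_smul, Real.norm_eq_abs]
    have h1 : ‖rotGen (U y) - fderiv ℝ U y (rotGen y)‖ ≤ ‖U y‖ + ‖fderiv ℝ U y‖ * r :=
      (norm_sub_le _ _).trans (add_le_add (norm_rotGen_le _)
        ((ContinuousLinearMap.le_opNorm _ _).trans
          (mul_le_mul_of_nonneg_left (norm_rotGen_le y) (norm_nonneg _))))
    calc (1 + r) * (|α| * ‖rotGen (U y) - fderiv ℝ U y (rotGen y)‖)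
        = |α| * ((1 + r) * ‖rotGen (U y) - fderiv ℝ U y (rotGen y)‖) := by ring
      _ ≤ |α| * ((1 + r) * (‖U y‖ + ‖fderiv ℝ U y‖ * r)) :=
          mul_le_mul_of_nonneg_left (mul_le_mul_of_nonneg_left h1 hw.le) ha
      _ = |α| * ((1 + r) * ‖U y‖ + (1 + r) * (‖fderiv ℝ U y‖ * r)) := by ring
      _ ≤ |α| * (C₀ + 2 * C₁) := mul_le_mul_of_nonneg_left (add_le_add bU bDy) ha
  have nb : (1 + r) * ‖(1 / 2 : ℝ) • U y‖ ≤ C₀ / 2 := by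
    rw [norm_smul, Real.norm_of_nonneg (by norm_num : (0 : ℝ) ≤ 1 / 2)]
    nlinarith
  have nc : (1 + r) * ‖(1 / 2 : ℝ) • fderiv ℝ U y y‖ ≤ C₁ := by
    rw [norm_smul, Real.norm_of_nonneg (by norm_num : (0 : ℝ) ≤ 1 / 2)]
    have h1 : ‖fderiv ℝ U y y‖ ≤ ‖fderiv ℝ U y‖ * r := by
      rw [hr]; exact ContinuousLinearMap.le_opNorm _ _
    nlinarith [mul_le_mul_of_nonneg_left h1 hw.le]
  have nd : (1 + r) * ‖(Δ U) y‖ ≤ 6 * C₂ := by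
    have h1 := norm_laplacian_le_three_mul_aux' hU y
    nlinarith [mul_le_mul_of_nonneg_left h1 hw.le]
  have ne : (1 + r) * ‖convect U U y‖ ≤ C₀ * C₁ := by
    rw [convect_apply]
    have h1 : ‖(fderiv ℝ U y) (U y)‖ ≤ ‖fderiv ℝ U y‖ * ‖U y‖ := ContinuousLinearMap.le_opNorm _ _
    calc (1 + r) * ‖(fderiv ℝ U y) (U y)‖ ≤ (1 + r) * (‖fderiv ℝ U y‖ * ‖U y‖) :=
          mul_le_mul_of_nonneg_left h1 hw.le
      _ = ‖fderiv ℝ U y‖ * ((1 + r) * ‖U y‖) := by ring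
      _ ≤ C₁ * C₀ := mul_le_mul bD bU (by positivity) hC1
      _ = C₀ * C₁ := mul_comm _ _
  have hsum : ∀ a b c d e : EuclideanSpace ℝ (Fin 3),
      ‖a + b + c - d + e‖ ≤ ‖a‖ + ‖b‖ + ‖c‖ + ‖d‖ + ‖e‖ := by
    intro a b c d e
    have h₁ := norm_add_le (a + b + c - d) e
    have h₂ := norm_sub_le (a + b + c) d
    have h₃ := norm_add_le (a + b) c
    have h₄ := norm_add_le a b
    linarith
  have h5 := mul_le_mul_of_nonneg_left (hsum (α • (rotGen (U y) - fderiv ℝ U y (rotGen y)))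
    ((1 / 2 : ℝ) • U y) ((1 / 2 : ℝ) • fderiv ℝ U y y) ((Δ U) y) (convect U U y)) hw.le
  linarith

/-- **Pineau–Vicol 2026, Lemma 8.1, proof — the slice derivative read off the equation (first
display, `k = 0`).** "Using these bounds, we deduce from the equation (1.14a) the bound
`|∂_s∇ᵏU(y, s)| ≤ C_{U,s}(1+|α|)(1+|y|)^{−k−1}`, `k ∈ {0,1,2,3}`" — here `k = 0`, on one time slice:
if `U ∈ C²` obeys (8.3) for `k ≤ 2` (`|U| ≤ C₀/(1+|y|)`, `|DU| ≤ C₁/(1+|y|²)`, `|D²U| ≤ C₂/(1+|y|³)`),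
the pressure gradient obeys `|∇P(y)| ≤ C_P/(1+|y|)` (implied by (8.3) for `P`, `k = 1`), and the
slice equation (1.14a) `∂_sU + α𝓡U + ½U + ½(y·∇)U − ΔU + (U·∇)U + ∇P = 0` holds with
`F = ∂_sU(·, s)`, then `|F(y)| ≤ (1 + |α|)(C₀ + 2C₁ + 6C₂ + C₀C₁ + C_P)/(1 + |y|)` — a constant
times `(1 + |α|)`, the constant depending on `C₀, C₁, C₂, C_P` only.
[cite: PineauVicol2026, Lemma 8.1, proof (p. 28); (1.14a) (p. 7)] -/
theorem norm_sliceDeriv_le_of_slice_equation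
    {U F : EuclideanSpace ℝ (Fin 3) → EuclideanSpace ℝ (Fin 3)} {P : EuclideanSpace ℝ (Fin 3) → ℝ}
    {α : ℝ} (hU : ContDiff ℝ 2 U) {C₀ C₁ C₂ CP : ℝ}
    (h19 : ∀ y, ‖U y‖ ≤ C₀ / (1 + ‖y‖)) (h21 : ∀ y, ‖fderiv ℝ U y‖ ≤ C₁ / (1 + ‖y‖ ^ 2))
    (h21' : ∀ y, ‖fderiv ℝ (fderiv ℝ U) y‖ ≤ C₂ / (1 + ‖y‖ ^ 3))
    (hP : ∀ y, ‖gradient P y‖ ≤ CP / (1 + ‖y‖))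
    (heq : ∀ y, α • (rotGen (U y) - fderiv ℝ U y (rotGen y)) + (1 / 2 : ℝ) • U y +
      (1 / 2 : ℝ) • fderiv ℝ U y y - (Δ U) y + convect U U y + gradient P y + F y = 0)
    (y : EuclideanSpace ℝ (Fin 3)) :
    ‖F y‖ ≤ (1 + |α|) * (C₀ + 2 * C₁ + 6 * C₂ + C₀ * C₁ + CP) / (1 + ‖y‖) := by
  have hw : 0 < 1 + ‖y‖ := by positivity
  have ha : 0 ≤ |α| := abs_nonneg α
  have hC0 : 0 ≤ C₀ := by
    have h := (norm_nonneg _).trans (h19 0); rw [norm_zero] at h; norm_num at h; exact h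
  have hC1 : 0 ≤ C₁ := by
    have h := (norm_nonneg _).trans (h21 0); rw [norm_zero] at h; norm_num at h; exact h
  have hC2 : 0 ≤ C₂ := by
    have h2 := h21' 0
    rw [norm_zero] at h2; norm_num at h2
    have hL0 : ‖(Δ U) 0‖ ≤ 3 * C₂ :=
      (norm_laplacian_le_three_mul_aux' hU 0).trans (mul_le_mul_of_nonneg_left h2 (by norm_num))
    have h0 := norm_nonneg ((Δ U) 0)
    linarith
  have hCP : 0 ≤ CP := by
    have h := (norm_nonneg _).trans (hP 0); rw [norm_zero] at h; norm_num at h; exact h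
  have hT := one_add_norm_mul_norm_profileTerms_le (α := α) hU h19 h21 h21' y
  have hPy : (1 + ‖y‖) * ‖gradient P y‖ ≤ CP := by
    have h := hP y; rw [le_div_iff₀ hw] at h; linarith
  have hF : F y = -(α • (rotGen (U y) - fderiv ℝ U y (rotGen y)) + (1 / 2 : ℝ) • U y +
      (1 / 2 : ℝ) • fderiv ℝ U y y - (Δ U) y + convect U U y + gradient P y) := by
    rw [eq_neg_iff_add_eq_zero, ← heq y]; abel
  rw [le_div_iff₀ hw, hF, norm_neg, mul_comm]
  refine (mul_le_mul_of_nonneg_left (norm_add_le _ _) hw.le).trans ?_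
  rw [mul_add]
  nlinarith [mul_nonneg ha hC0, mul_nonneg ha hC1, mul_nonneg ha hC2, mul_nonneg ha hCP,
    mul_nonneg ha (mul_nonneg hC0 hC1)]

/-- **Pineau–Vicol 2026, Lemma 8.1, proof — the last step** ("Recalling that `U` is `[0, S]`-periodic
in time, Poincaré's inequality in `s` then gives the bound (8.2)"), as the elementary statement it
uses, for a curve in a real Banach space: if `f : ℝ → F` is `S`-periodic (`S > 0`) with derivative
`f'`, and `f'` has derivative `f''` with `‖f''(s)‖ ≤ M` for all `s`, then `‖f'(s)‖ ≤ M S / 2` for all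
`s` (the mean of `f'` over a period vanishes, `∫₀^S f'(s+τ) dτ = f(s+S) − f(s) = 0`, and
`‖f'(s) − f'(s+τ)‖ ≤ Mτ`). Applied at fixed `y` to `s ↦ U(y, s)` with `M = C(1+|α|)²(1+|y|)⁻¹`
(the bound on `∂²_sU`) this is the first half of (8.2); applied to `s ↦ ∇U(y, s)`, the second.
[cite: PineauVicol2026, Lemma 8.1, proof (p. 28)] -/
theorem norm_deriv_le_of_periodic {F : Type*} [NormedAddCommGroup F] [NormedSpace ℝ F]
    [CompleteSpace F] {f f' f'' : ℝ → F} {S M : ℝ} (hS : 0 < S)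
    (hper : Function.Periodic f S) (hf : ∀ s, HasDerivAt f (f' s) s)
    (hf' : ∀ s, HasDerivAt f' (f'' s) s) (hM : ∀ s, ‖f'' s‖ ≤ M) (s : ℝ) :
    ‖f' s‖ ≤ M * S / 2 := by
  have hM0 : 0 ≤ M := (norm_nonneg _).trans (hM 0)
  have hc' : Continuous f' := continuous_iff_continuousAt.2 fun x => (hf' x).continuousAt
  -- the mean of `f'` over a period vanishes
  have hmean : ∫ τ in (0 : ℝ)..S, f' (s + τ) = 0 := by
    have hderiv : ∀ τ ∈ Set.uIcc (0 : ℝ) S, HasDerivAt (fun τ => f (s + τ)) (f' (s + τ)) τ := by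
      intro τ _
      have h := (hf (s + τ)).comp_const_add s τ
      simpa using h
    have hint : IntervalIntegrable (fun τ => f' (s + τ)) volume 0 S :=
      (hc'.comp (continuous_const.add continuous_id)).intervalIntegrable _ _
    rw [intervalIntegral.integral_eq_sub_of_hasDerivAt hderiv hint]
    simp only [add_zero]
    rw [hper s, sub_self]
  -- Lipschitz bound on `f'` from `‖f''‖ ≤ M`
  have hlip : ∀ τ, 0 ≤ τ → ‖f' (s + τ) - f' s‖ ≤ M * τ := by
    intro τ hτ
    have h := norm_image_sub_le_of_norm_deriv_le_segment' (f := f') (f' := f'') (a := s)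
      (b := s + τ) (C := M) (fun x _ => (hf' x).hasDerivWithinAt) (fun x _ => hM x) (s + τ)
      (by constructor <;> linarith)
    simpa using h
  -- `S • f'(s) = ∫₀^S (f'(s) − f'(s+τ)) dτ`
  have hconst : ∫ τ in (0 : ℝ)..S, f' s = S • f' s := by
    rw [intervalIntegral.integral_const, sub_zero]
  have hint1 : IntervalIntegrable (fun _ : ℝ => f' s) volume 0 S := intervalIntegrable_const
  have hint2 : IntervalIntegrable (fun τ => f' (s + τ)) volume 0 S :=
    (hc'.comp (continuous_const.add continuous_id)).intervalIntegrable _ _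
  have hrepr : S • f' s = ∫ τ in (0 : ℝ)..S, (f' s - f' (s + τ)) := by
    rw [intervalIntegral.integral_sub hint1 hint2, hmean, sub_zero, hconst]
  -- norm bound
  have hbound : ‖∫ τ in (0 : ℝ)..S, (f' s - f' (s + τ))‖ ≤ ∫ τ in (0 : ℝ)..S, M * τ := by
    refine intervalIntegral.norm_integral_le_of_norm_le hS.le ?_ ?_
    · exact Filter.Eventually.of_forall fun τ hτ => by
        rw [norm_sub_rev]; exact hlip τ hτ.1.le
    · exact (continuous_const.mul continuous_id).intervalIntegrable _ _
  have hval : ∫ τ in (0 : ℝ)..S, M * τ = M * (S ^ 2 / 2) := by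
    rw [intervalIntegral.integral_const_mul, integral_id]; ring
  have h1 : S * ‖f' s‖ ≤ M * (S ^ 2 / 2) := by
    have h := hbound
    rw [hval, ← hrepr, norm_smul, Real.norm_of_nonneg hS.le] at h
    exact h
  have h2 : S * ‖f' s‖ ≤ S * (M * S / 2) := by
    calc S * ‖f' s‖ ≤ M * (S ^ 2 / 2) := h1
      _ = S * (M * S / 2) := by ring
  exact le_of_mul_le_mul_left h2 hS

/-- `‖J‖ ≤ 1` as an operator. [folklore] -/
private theorem norm_rotGenL_le_one' : ‖rotGenL‖ ≤ 1 :=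
  ContinuousLinearMap.opNorm_le_bound _ zero_le_one fun v => by
    rw [rotGenL_apply, one_mul]; exact norm_rotGen_le v

set_option maxHeartbeats 1600000 in
/-- **Pineau–Vicol 2026, Lemma 8.1, proof — the first display with `k = 1`** (the GRADIENT of the
slice derivative, read off the `y`-derivative of (1.14a)): on one slice, if `U ∈ C³`, `P ∈ C²`,
`U` obeys (8.3) for `k ≤ 2` (`|U| ≤ C₀/(1+|y|)`, `|DU| ≤ C₁/(1+|y|²)`, `|D²U| ≤ C₂/(1+|y|³)`) and
`|D(ΔU)(y)| ≤ C₃/(1+|y|)²` (a consequence of (8.3) for `U` with `k = 3` — `‖D(ΔU)‖ ≤ 3√3 ‖D³U‖`,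
the tree's `norm_fderiv_laplacian_sq_le` — assumed here in this weaker form), the pressure obeys
`|D∇P(y)| ≤ C_{P,2}/(1+|y|)²` (weaker than (8.3) for `P` with `k = 2`, which is not yet a tree
theorem), and the slice equation (1.14a) `∂_sU + α𝓡U + ½U + ½(y·∇)U − ΔU + (U·∇)U + ∇P = 0`
holds with `F = ∂_sU(·, s)`, then
`‖DF(y)‖ ≤ (1 + |α|)(4C₁ + 3C₂ + C₃ + 2C₁² + 2C₀C₂ + C_{P,2})/(1 + |y|)²`
(`DF = −[α(J∘DU − DU∘J − D²U(·)(Jy)) + ½DU + ½(DU + D²U(·)(y)) − D(ΔU) + DU∘DU + D²U(·)(U) + D∇P]`,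
`‖J‖ ≤ 1`, `|Jy| ≤ |y|`, and `(1+|y|)² ≤ 2(1+|y|²)`, `|y|(1+|y|)² ≤ 3(1+|y|³)`,
`1+|y| ≤ 2(1+|y|³)`). [cite: PineauVicol2026, Lemma 8.1, proof (p. 28); (1.14a) (p. 7)] -/
theorem norm_fderiv_sliceDeriv_le_of_slice_equation
    {U F : EuclideanSpace ℝ (Fin 3) → EuclideanSpace ℝ (Fin 3)} {P : EuclideanSpace ℝ (Fin 3) → ℝ}
    {α : ℝ} (hU : ContDiff ℝ 3 U) (hP : ContDiff ℝ 2 P) {C₀ C₁ C₂ C₃ CP : ℝ}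
    (h19 : ∀ y, ‖U y‖ ≤ C₀ / (1 + ‖y‖)) (h21 : ∀ y, ‖fderiv ℝ U y‖ ≤ C₁ / (1 + ‖y‖ ^ 2))
    (h21' : ∀ y, ‖fderiv ℝ (fderiv ℝ U) y‖ ≤ C₂ / (1 + ‖y‖ ^ 3))
    (hΔ : ∀ y, ‖fderiv ℝ (Δ U) y‖ ≤ C₃ / (1 + ‖y‖) ^ 2)
    (hP2 : ∀ y, ‖fderiv ℝ (gradient P) y‖ ≤ CP / (1 + ‖y‖) ^ 2)
    (heq : ∀ y, α • (rotGen (U y) - fderiv ℝ U y (rotGen y)) + (1 / 2 : ℝ) • U y +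
      (1 / 2 : ℝ) • fderiv ℝ U y y - (Δ U) y + convect U U y + gradient P y + F y = 0)
    (y : EuclideanSpace ℝ (Fin 3)) :
    ‖fderiv ℝ F y‖ ≤
      (1 + |α|) * (4 * C₁ + 3 * C₂ + C₃ + 2 * C₁ ^ 2 + 2 * C₀ * C₂ + CP) / (1 + ‖y‖) ^ 2 := by
  set r : ℝ := ‖y‖ with hr
  have hr0 : 0 ≤ r := norm_nonneg y
  have hw : 0 < 1 + r := by positivity
  have hw2 : 0 < (1 + r) ^ 2 := by positivity
  have ha : 0 ≤ |α| := abs_nonneg α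
  have hC0 : 0 ≤ C₀ := by
    have h := (norm_nonneg _).trans (h19 0); rw [norm_zero] at h; norm_num at h; exact h
  have hC1 : 0 ≤ C₁ := by
    have h := (norm_nonneg _).trans (h21 0); rw [norm_zero] at h; norm_num at h; exact h
  have hC2 : 0 ≤ C₂ := by
    have h := h21' 0
    rw [norm_zero] at h; norm_num at h
    have h0 : (0 : ℝ) ≤ ‖fderiv ℝ (fderiv ℝ U) (0 : EuclideanSpace ℝ (Fin 3))‖ := by positivity
    linarith
  have hC3 : 0 ≤ C₃ := by
    have h := (norm_nonneg _).trans (hΔ 0); rw [norm_zero] at h; norm_num at h; exact h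
  have hCP : 0 ≤ CP := by
    have h := (norm_nonneg _).trans (hP2 0); rw [norm_zero] at h; norm_num at h; exact h
  -- differentiability
  have hU1 : Differentiable ℝ U := hU.differentiable (by norm_num)
  have hDU : ContDiff ℝ 2 (fderiv ℝ U) := hU.fderiv_right (m := 2) (by norm_num)
  have hDUd : Differentiable ℝ (fderiv ℝ U) := hDU.differentiable (by norm_num)
  have hΔd : Differentiable ℝ (Δ U) :=
    (contDiff_laplacian (n := 1) (by exact_mod_cast hU)).differentiable one_ne_zero
  have hgP : Differentiable ℝ (gradient P) := by
    have h1 : ContDiff ℝ 1 (fderiv ℝ P) := hP.fderiv_right (m := 1) (by norm_num)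
    have h2 : gradient P = fun x => (InnerProductSpace.toDual ℝ (EuclideanSpace ℝ (Fin 3))).symm
        (fderiv ℝ P x) := rfl
    rw [h2]
    exact (InnerProductSpace.toDual ℝ (EuclideanSpace ℝ (Fin 3))).symm.differentiable.comp
      (h1.differentiable one_ne_zero)
  -- `F` as a function
  have hF : F = fun y => -(α • (rotGenL (U y) - fderiv ℝ U y (rotGenL y)) + (1 / 2 : ℝ) • U y +
      (1 / 2 : ℝ) • fderiv ℝ U y y - (Δ U) y + (fderiv ℝ U y) (U y) + gradient P y) := by
    funext z
    have hz := heq z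
    rw [convect_apply] at hz
    rw [eq_neg_iff_add_eq_zero, rotGenL_apply, rotGenL_apply, ← hz]
    abel
  -- derivatives of the pieces at `y`
  have dJU : HasFDerivAt (fun z => rotGenL (U z)) (rotGenL.comp (fderiv ℝ U y)) y :=
    rotGenL.hasFDerivAt.comp y (hU1 y).hasFDerivAt
  have dDUJ : HasFDerivAt (fun z => fderiv ℝ U z (rotGenL z))
      ((fderiv ℝ U y).comp rotGenL + (fderiv ℝ (fderiv ℝ U) y).flip (rotGenL y)) y :=
    (hDUd y).hasFDerivAt.clm_apply rotGenL.hasFDerivAt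
  have dDUy : HasFDerivAt (fun z => fderiv ℝ U z z)
      ((fderiv ℝ U y).comp (ContinuousLinearMap.id ℝ _) + (fderiv ℝ (fderiv ℝ U) y).flip y) y :=
    (hDUd y).hasFDerivAt.clm_apply (hasFDerivAt_id y)
  have dconv : HasFDerivAt (fun z => (fderiv ℝ U z) (U z))
      ((fderiv ℝ U y).comp (fderiv ℝ U y) + (fderiv ℝ (fderiv ℝ U) y).flip (U y)) y :=
    (hDUd y).hasFDerivAt.clm_apply (hU1 y).hasFDerivAt
  have dall : HasFDerivAt F (-(α • (rotGenL.comp (fderiv ℝ U y) -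
      ((fderiv ℝ U y).comp rotGenL + (fderiv ℝ (fderiv ℝ U) y).flip (rotGenL y))) +
      (1 / 2 : ℝ) • fderiv ℝ U y +
      (1 / 2 : ℝ) • ((fderiv ℝ U y).comp (ContinuousLinearMap.id ℝ _) + (fderiv ℝ (fderiv ℝ U) y).flip y) -
      fderiv ℝ (Δ U) y +
      ((fderiv ℝ U y).comp (fderiv ℝ U y) + (fderiv ℝ (fderiv ℝ U) y).flip (U y)) +
      fderiv ℝ (gradient P) y)) y := by
    rw [hF]
    exact ((((((dJU.sub dDUJ).const_smul α).add ((hU1 y).hasFDerivAt.const_smul (1 / 2 : ℝ))).add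
      (dDUy.const_smul (1 / 2 : ℝ))).sub (hΔd y).hasFDerivAt).add dconv |>.add
      (hgP y).hasFDerivAt).neg
  rw [dall.fderiv, norm_neg]
  -- weighted bounds on the building blocks
  have nJ : ‖rotGenL‖ ≤ 1 := norm_rotGenL_le_one'
  have nJy : ‖rotGenL y‖ ≤ r := by rw [rotGenL_apply, hr]; exact norm_rotGen_le y
  have b1 : (1 + r) ^ 2 * ‖fderiv ℝ U y‖ ≤ 2 * C₁ := by
    have h := h21 y; rw [← hr] at h
    have h2 : 0 < 1 + r ^ 2 := by positivity
    have h3 : ‖fderiv ℝ U y‖ * (1 + r ^ 2) ≤ C₁ := by rwa [le_div_iff₀ h2] at h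
    have h4 : (1 + r) ^ 2 ≤ 2 * (1 + r ^ 2) := by nlinarith [sq_nonneg (r - 1)]
    have hn : 0 ≤ ‖fderiv ℝ U y‖ := norm_nonneg _
    nlinarith
  have b2 : (1 + r) ^ 2 * (‖fderiv ℝ (fderiv ℝ U) y‖ * r) ≤ 3 * C₂ := by
    have h := h21' y; rw [← hr] at h
    have h2 : 0 < 1 + r ^ 3 := by positivity
    have h3 : ‖fderiv ℝ (fderiv ℝ U) y‖ * (1 + r ^ 3) ≤ C₂ := by rwa [le_div_iff₀ h2] at h
    have h4 : (1 + r) ^ 2 * r ≤ 3 * (1 + r ^ 3) := by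
      nlinarith [sq_nonneg (r - 1), mul_nonneg hr0 (sq_nonneg (r - 1)), sq_nonneg r]
    have hn : 0 ≤ ‖fderiv ℝ (fderiv ℝ U) y‖ := by positivity
    calc (1 + r) ^ 2 * (‖fderiv ℝ (fderiv ℝ U) y‖ * r)
        = ‖fderiv ℝ (fderiv ℝ U) y‖ * ((1 + r) ^ 2 * r) := by ring
      _ ≤ ‖fderiv ℝ (fderiv ℝ U) y‖ * (3 * (1 + r ^ 3)) := mul_le_mul_of_nonneg_left h4 hn
      _ = 3 * (‖fderiv ℝ (fderiv ℝ U) y‖ * (1 + r ^ 3)) := by ring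
      _ ≤ 3 * C₂ := by linarith
  have b2' : (1 + r) ^ 2 * (‖fderiv ℝ (fderiv ℝ U) y‖ * ‖U y‖) ≤ 2 * C₀ * C₂ := by
    have h := h21' y; rw [← hr] at h
    have h0 := h19 y; rw [← hr] at h0
    have h2 : 0 < 1 + r ^ 3 := by positivity
    have h3 : ‖fderiv ℝ (fderiv ℝ U) y‖ * (1 + r ^ 3) ≤ C₂ := by rwa [le_div_iff₀ h2] at h
    have h5 : ‖U y‖ * (1 + r) ≤ C₀ := by rwa [le_div_iff₀ hw] at h0
    have h4 : (1 + r) ≤ 2 * (1 + r ^ 3) := by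
      nlinarith [mul_nonneg hr0 (sq_nonneg (r - 1)), sq_nonneg (2 * r - 1)]
    have hn : 0 ≤ ‖fderiv ℝ (fderiv ℝ U) y‖ := by positivity
    have hn0 : 0 ≤ ‖U y‖ := norm_nonneg _
    calc (1 + r) ^ 2 * (‖fderiv ℝ (fderiv ℝ U) y‖ * ‖U y‖)
        = (‖fderiv ℝ (fderiv ℝ U) y‖ * (1 + r)) * (‖U y‖ * (1 + r)) := by ring
      _ ≤ (‖fderiv ℝ (fderiv ℝ U) y‖ * (2 * (1 + r ^ 3))) * C₀ :=
          mul_le_mul (mul_le_mul_of_nonneg_left h4 hn) h5 (by positivity) (by positivity)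
      _ = 2 * C₀ * (‖fderiv ℝ (fderiv ℝ U) y‖ * (1 + r ^ 3)) := by ring
      _ ≤ 2 * C₀ * C₂ := by nlinarith
  have b11 : (1 + r) ^ 2 * (‖fderiv ℝ U y‖ * ‖fderiv ℝ U y‖) ≤ 2 * C₁ ^ 2 := by
    have hD : ‖fderiv ℝ U y‖ ≤ C₁ := (h21 y).trans (div_le_self hC1 (by nlinarith [norm_nonneg y]))
    have hn : 0 ≤ ‖fderiv ℝ U y‖ := norm_nonneg _
    calc (1 + r) ^ 2 * (‖fderiv ℝ U y‖ * ‖fderiv ℝ U y‖)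
        = ((1 + r) ^ 2 * ‖fderiv ℝ U y‖) * ‖fderiv ℝ U y‖ := by ring
      _ ≤ (2 * C₁) * C₁ := mul_le_mul b1 hD hn (by positivity)
      _ = 2 * C₁ ^ 2 := by ring
  have b3 : (1 + r) ^ 2 * ‖fderiv ℝ (Δ U) y‖ ≤ C₃ := by
    have h := hΔ y; rw [← hr, le_div_iff₀ hw2] at h; linarith
  have b4 : (1 + r) ^ 2 * ‖fderiv ℝ (gradient P) y‖ ≤ CP := by
    have h := hP2 y; rw [← hr, le_div_iff₀ hw2] at h; linarith
  -- operator-norm bounds of the composite pieces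
  have n1 : ‖rotGenL.comp (fderiv ℝ U y)‖ ≤ ‖fderiv ℝ U y‖ :=
    (ContinuousLinearMap.opNorm_comp_le _ _).trans (mul_le_of_le_one_left (norm_nonneg _) nJ)
  have n2 : ‖(fderiv ℝ U y).comp rotGenL + (fderiv ℝ (fderiv ℝ U) y).flip (rotGenL y)‖ ≤
      ‖fderiv ℝ U y‖ + ‖fderiv ℝ (fderiv ℝ U) y‖ * r := by
    refine (norm_add_le _ _).trans (add_le_add ?_ ?_)
    · exact (ContinuousLinearMap.opNorm_comp_le _ _).trans (mul_le_of_le_one_right (norm_nonneg _) nJ)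
    · refine (ContinuousLinearMap.le_opNorm _ _).trans ?_
      rw [ContinuousLinearMap.opNorm_flip]
      exact mul_le_mul_of_nonneg_left nJy (by positivity)
  have n3 : ‖(fderiv ℝ U y).comp (ContinuousLinearMap.id ℝ _) + (fderiv ℝ (fderiv ℝ U) y).flip y‖ ≤
      ‖fderiv ℝ U y‖ + ‖fderiv ℝ (fderiv ℝ U) y‖ * r := by
    refine (norm_add_le _ _).trans (add_le_add ?_ ?_)
    · rw [ContinuousLinearMap.comp_id]
    · refine (ContinuousLinearMap.le_opNorm _ _).trans ?_
      rw [ContinuousLinearMap.opNorm_flip, hr]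
  have n4 : ‖(fderiv ℝ U y).comp (fderiv ℝ U y) + (fderiv ℝ (fderiv ℝ U) y).flip (U y)‖ ≤
      ‖fderiv ℝ U y‖ * ‖fderiv ℝ U y‖ + ‖fderiv ℝ (fderiv ℝ U) y‖ * ‖U y‖ := by
    refine (norm_add_le _ _).trans (add_le_add (ContinuousLinearMap.opNorm_comp_le _ _) ?_)
    refine (ContinuousLinearMap.le_opNorm _ _).trans ?_
    rw [ContinuousLinearMap.opNorm_flip]
  -- assemble
  have hsum : ∀ a b c d e f : EuclideanSpace ℝ (Fin 3) →L[ℝ] EuclideanSpace ℝ (Fin 3),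
      ‖a + b + c - d + e + f‖ ≤ ‖a‖ + ‖b‖ + ‖c‖ + ‖d‖ + ‖e‖ + ‖f‖ := by
    intro a b c d e f
    have h₀ := norm_add_le (a + b + c - d + e) f
    have h₁ := norm_add_le (a + b + c - d) e
    have h₂ := norm_sub_le (a + b + c) d
    have h₃ := norm_add_le (a + b) c
    have h₄ := norm_add_le a b
    linarith
  have na : ‖α • (rotGenL.comp (fderiv ℝ U y) -
      ((fderiv ℝ U y).comp rotGenL + (fderiv ℝ (fderiv ℝ U) y).flip (rotGenL y)))‖ ≤
      |α| * (2 * ‖fderiv ℝ U y‖ + ‖fderiv ℝ (fderiv ℝ U) y‖ * r) := by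
    rw [norm_smul, Real.norm_eq_abs]
    refine mul_le_mul_of_nonneg_left ((norm_sub_le _ _).trans ?_) ha
    linarith
  have nb : ‖(1 / 2 : ℝ) • fderiv ℝ U y‖ ≤ 1 / 2 * ‖fderiv ℝ U y‖ := by
    rw [norm_smul, Real.norm_of_nonneg (by norm_num : (0 : ℝ) ≤ 1 / 2)]
  have nc : ‖(1 / 2 : ℝ) • ((fderiv ℝ U y).comp (ContinuousLinearMap.id ℝ _) +
      (fderiv ℝ (fderiv ℝ U) y).flip y)‖ ≤ 1 / 2 * (‖fderiv ℝ U y‖ + ‖fderiv ℝ (fderiv ℝ U) y‖ * r) := by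
    rw [norm_smul, Real.norm_of_nonneg (by norm_num : (0 : ℝ) ≤ 1 / 2)]
    exact mul_le_mul_of_nonneg_left n3 (by norm_num)
  have htot := hsum (α • (rotGenL.comp (fderiv ℝ U y) -
      ((fderiv ℝ U y).comp rotGenL + (fderiv ℝ (fderiv ℝ U) y).flip (rotGenL y))))
      ((1 / 2 : ℝ) • fderiv ℝ U y)
      ((1 / 2 : ℝ) • ((fderiv ℝ U y).comp (ContinuousLinearMap.id ℝ _) + (fderiv ℝ (fderiv ℝ U) y).flip y))
      (fderiv ℝ (Δ U) y)
      ((fderiv ℝ U y).comp (fderiv ℝ U y) + (fderiv ℝ (fderiv ℝ U) y).flip (U y))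
      (fderiv ℝ (gradient P) y)
  -- stage 1: operator norms
  set a : ℝ := ‖fderiv ℝ U y‖ with ha_def
  set b : ℝ := ‖fderiv ℝ (fderiv ℝ U) y‖ * r with hb_def
  set c : ℝ := ‖fderiv ℝ (Δ U) y‖ with hc_def
  set d : ℝ := ‖fderiv ℝ (fderiv ℝ U) y‖ * ‖U y‖ with hd_def
  set e : ℝ := ‖fderiv ℝ (gradient P) y‖ with he_def
  have stage1 : ‖α • (rotGenL.comp (fderiv ℝ U y) -
      ((fderiv ℝ U y).comp rotGenL + (fderiv ℝ (fderiv ℝ U) y).flip (rotGenL y))) +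
      (1 / 2 : ℝ) • fderiv ℝ U y +
      (1 / 2 : ℝ) • ((fderiv ℝ U y).comp (ContinuousLinearMap.id ℝ _) + (fderiv ℝ (fderiv ℝ U) y).flip y) -
      fderiv ℝ (Δ U) y +
      ((fderiv ℝ U y).comp (fderiv ℝ U y) + (fderiv ℝ (fderiv ℝ U) y).flip (U y)) +
      fderiv ℝ (gradient P) y‖ ≤
      |α| * (2 * a + b) + 1 / 2 * a + 1 / 2 * (a + b) + c + (a * a + d) + e := by
    linarith [na, nb, nc, n4, htot]
  -- stage 2: weights
  have w2a : (1 + r) ^ 2 * a ≤ 2 * C₁ := b1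
  have w2b : (1 + r) ^ 2 * b ≤ 3 * C₂ := b2
  have w2c : (1 + r) ^ 2 * c ≤ C₃ := b3
  have w2d : (1 + r) ^ 2 * d ≤ 2 * C₀ * C₂ := b2'
  have w2aa : (1 + r) ^ 2 * (a * a) ≤ 2 * C₁ ^ 2 := b11
  have w2e : (1 + r) ^ 2 * e ≤ CP := b4
  have key : (1 + r) ^ 2 * (|α| * (2 * a + b) + 1 / 2 * a + 1 / 2 * (a + b) + c + (a * a + d) + e) =
      |α| * (2 * ((1 + r) ^ 2 * a) + (1 + r) ^ 2 * b) + 1 / 2 * ((1 + r) ^ 2 * a) +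
      1 / 2 * ((1 + r) ^ 2 * a + (1 + r) ^ 2 * b) + (1 + r) ^ 2 * c +
      ((1 + r) ^ 2 * (a * a) + (1 + r) ^ 2 * d) + (1 + r) ^ 2 * e := by ring
  have t1 : |α| * (2 * ((1 + r) ^ 2 * a) + (1 + r) ^ 2 * b) ≤ |α| * (4 * C₁ + 3 * C₂) :=
    mul_le_mul_of_nonneg_left (by linarith) ha
  rw [le_div_iff₀ hw2, mul_comm]
  calc (1 + r) ^ 2 * ‖α • (rotGenL.comp (fderiv ℝ U y) -
      ((fderiv ℝ U y).comp rotGenL + (fderiv ℝ (fderiv ℝ U) y).flip (rotGenL y))) +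
      (1 / 2 : ℝ) • fderiv ℝ U y +
      (1 / 2 : ℝ) • ((fderiv ℝ U y).comp (ContinuousLinearMap.id ℝ _) + (fderiv ℝ (fderiv ℝ U) y).flip y) -
      fderiv ℝ (Δ U) y +
      ((fderiv ℝ U y).comp (fderiv ℝ U y) + (fderiv ℝ (fderiv ℝ U) y).flip (U y)) +
      fderiv ℝ (gradient P) y‖
      ≤ (1 + r) ^ 2 * (|α| * (2 * a + b) + 1 / 2 * a + 1 / 2 * (a + b) + c + (a * a + d) + e) :=
        mul_le_mul_of_nonneg_left stage1 hw2.le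
    _ = _ := key
    _ ≤ |α| * (4 * C₁ + 3 * C₂) + C₁ + (2 * C₁ + 3 * C₂) / 2 + C₃ + (2 * C₁ ^ 2 + 2 * C₀ * C₂) + CP := by
        linarith
    _ ≤ (1 + |α|) * (4 * C₁ + 3 * C₂ + C₃ + 2 * C₁ ^ 2 + 2 * C₀ * C₂ + CP) := by
        nlinarith [mul_nonneg ha hC3, mul_nonneg ha hCP, mul_nonneg ha (sq_nonneg C₁),
          mul_nonneg ha (mul_nonneg hC0 hC2), sq_nonneg C₁, mul_nonneg hC0 hC2]

/-! ### Lemma 8.1, proof: `∂ₛ` applied to (1.14a) (third display, `k = 0` and `k = 1`) -/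

/-- The four LINEAR profile terms of the `s`-differentiated equation (1.14a) decay like `(1+|y|)⁻¹`:
`(1+|y|) |α𝓡V + ½V + ½(y·∇)V − ΔV|(y) ≤ |α|(D₀ + 2D₁) + D₀/2 + D₁ + 6D₂` when `|V| ≤ D₀/(1+|y|)`,
`|DV| ≤ D₁/(1+|y|²)`, `|D²V| ≤ D₂/(1+|y|³)` (as in `one_add_norm_mul_norm_profileTerms_le`, without
the convective term). [folklore] -/
private theorem one_add_norm_mul_norm_linearTerms_le
    {V : EuclideanSpace ℝ (Fin 3) → EuclideanSpace ℝ (Fin 3)} {α : ℝ}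
    (hV : ContDiff ℝ 2 V) {D₀ D₁ D₂ : ℝ} (h0 : ∀ y, ‖V y‖ ≤ D₀ / (1 + ‖y‖))
    (h1 : ∀ y, ‖fderiv ℝ V y‖ ≤ D₁ / (1 + ‖y‖ ^ 2))
    (h2 : ∀ y, ‖fderiv ℝ (fderiv ℝ V) y‖ ≤ D₂ / (1 + ‖y‖ ^ 3)) (y : EuclideanSpace ℝ (Fin 3)) :
    (1 + ‖y‖) * ‖α • (rotGen (V y) - fderiv ℝ V y (rotGen y)) + (1 / 2 : ℝ) • V y +
        (1 / 2 : ℝ) • fderiv ℝ V y y - (Δ V) y‖ ≤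
      |α| * (D₀ + 2 * D₁) + D₀ / 2 + D₁ + 6 * D₂ := by
  set r : ℝ := ‖y‖ with hr
  have hr0 : 0 ≤ r := norm_nonneg y
  have hw : 0 < 1 + r := by positivity
  have ha : 0 ≤ |α| := abs_nonneg α
  have hD0 : 0 ≤ D₀ := by
    have h := (norm_nonneg _).trans (h0 0); rw [norm_zero] at h; norm_num at h; exact h
  have hD1 : 0 ≤ D₁ := by
    have h := (norm_nonneg _).trans (h1 0); rw [norm_zero] at h; norm_num at h; exact h
  -- the weighted bounds
  have bV : (1 + r) * ‖V y‖ ≤ D₀ := by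
    have h := h0 y; rw [← hr, le_div_iff₀ hw] at h; linarith
  have bDy : (1 + r) * (‖fderiv ℝ V y‖ * r) ≤ 2 * D₁ := by
    have h := h1 y
    rw [← hr] at h
    have h2' : 0 < 1 + r ^ 2 := by positivity
    have h3 : ‖fderiv ℝ V y‖ * (1 + r ^ 2) ≤ D₁ := by rwa [le_div_iff₀ h2'] at h
    have h4 : (1 + r) * r ≤ 2 * (1 + r ^ 2) := by nlinarith [sq_nonneg (r - 1)]
    calc (1 + r) * (‖fderiv ℝ V y‖ * r) = ‖fderiv ℝ V y‖ * ((1 + r) * r) := by ring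
      _ ≤ ‖fderiv ℝ V y‖ * (2 * (1 + r ^ 2)) :=
          mul_le_mul_of_nonneg_left h4 (norm_nonneg _)
      _ = 2 * (‖fderiv ℝ V y‖ * (1 + r ^ 2)) := by ring
      _ ≤ 2 * D₁ := by linarith
  have bD2 : (1 + r) * ‖fderiv ℝ (fderiv ℝ V) y‖ ≤ 2 * D₂ := by
    have h := h2 y
    rw [← hr] at h
    have h2' : 0 < 1 + r ^ 3 := by positivity
    have h3 : ‖fderiv ℝ (fderiv ℝ V) y‖ * (1 + r ^ 3) ≤ D₂ := by rwa [le_div_iff₀ h2'] at h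
    have h4 : (1 + r) ≤ 2 * (1 + r ^ 3) := by
      nlinarith [mul_nonneg hr0 (sq_nonneg (r - 1)), sq_nonneg (2 * r - 1)]
    have hn : 0 ≤ ‖fderiv ℝ (fderiv ℝ V) y‖ := by positivity
    calc (1 + r) * ‖fderiv ℝ (fderiv ℝ V) y‖ ≤ 2 * (1 + r ^ 3) * ‖fderiv ℝ (fderiv ℝ V) y‖ :=
          mul_le_mul_of_nonneg_right h4 hn
      _ = 2 * (‖fderiv ℝ (fderiv ℝ V) y‖ * (1 + r ^ 3)) := by ring
      _ ≤ 2 * D₂ := by linarith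
  -- the four terms
  have na : (1 + r) * ‖α • (rotGen (V y) - fderiv ℝ V y (rotGen y))‖ ≤ |α| * (D₀ + 2 * D₁) := by
    rw [norm_smul, Real.norm_eq_abs]
    have h1' : ‖rotGen (V y) - fderiv ℝ V y (rotGen y)‖ ≤ ‖V y‖ + ‖fderiv ℝ V y‖ * r :=
      (norm_sub_le _ _).trans (add_le_add (norm_rotGen_le _)
        ((ContinuousLinearMap.le_opNorm _ _).trans
          (mul_le_mul_of_nonneg_left (norm_rotGen_le y) (norm_nonneg _))))
    calc (1 + r) * (|α| * ‖rotGen (V y) - fderiv ℝ V y (rotGen y)‖)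
        = |α| * ((1 + r) * ‖rotGen (V y) - fderiv ℝ V y (rotGen y)‖) := by ring
      _ ≤ |α| * ((1 + r) * (‖V y‖ + ‖fderiv ℝ V y‖ * r)) :=
          mul_le_mul_of_nonneg_left (mul_le_mul_of_nonneg_left h1' hw.le) ha
      _ = |α| * ((1 + r) * ‖V y‖ + (1 + r) * (‖fderiv ℝ V y‖ * r)) := by ring
      _ ≤ |α| * (D₀ + 2 * D₁) := mul_le_mul_of_nonneg_left (add_le_add bV bDy) ha
  have nb : (1 + r) * ‖(1 / 2 : ℝ) • V y‖ ≤ D₀ / 2 := by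
    rw [norm_smul, Real.norm_of_nonneg (by norm_num : (0 : ℝ) ≤ 1 / 2)]
    nlinarith
  have nc : (1 + r) * ‖(1 / 2 : ℝ) • fderiv ℝ V y y‖ ≤ D₁ := by
    rw [norm_smul, Real.norm_of_nonneg (by norm_num : (0 : ℝ) ≤ 1 / 2)]
    have h1' : ‖fderiv ℝ V y y‖ ≤ ‖fderiv ℝ V y‖ * r := by
      rw [hr]; exact ContinuousLinearMap.le_opNorm _ _
    nlinarith [mul_le_mul_of_nonneg_left h1' hw.le]
  have nd : (1 + r) * ‖(Δ V) y‖ ≤ 6 * D₂ := by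
    have h1' := norm_laplacian_le_three_mul_aux' hV y
    nlinarith [mul_le_mul_of_nonneg_left h1' hw.le]
  have hsum : ∀ a b c d : EuclideanSpace ℝ (Fin 3), ‖a + b + c - d‖ ≤ ‖a‖ + ‖b‖ + ‖c‖ + ‖d‖ := by
    intro a b c d
    have h₂ := norm_sub_le (a + b + c) d
    have h₃ := norm_add_le (a + b) c
    have h₄ := norm_add_le a b
    linarith
  have h4 := mul_le_mul_of_nonneg_left (hsum (α • (rotGen (V y) - fderiv ℝ V y (rotGen y)))
    ((1 / 2 : ℝ) • V y) ((1 / 2 : ℝ) • fderiv ℝ V y y) ((Δ V) y)) hw.le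
  linarith

/-- **Pineau–Vicol 2026, Lemma 8.1, proof — `∂ₛ` applied to the equation (third display, `k = 0`).**
"However, by applying `∂ₛ` to (1.14a) and using the above bounds, along with (8.3), we obtain
`|∂²ₛU(y, s)| ≤ C_{U,s}(1+|α|)²(1+|y|)⁻¹`" — on one time slice, as the algebra it is: the
`s`-derivative of (1.14a) is the LINEAR equation
`∂ₛV + α𝓡V + ½V + ½(y·∇)V − ΔV + (V·∇)U + (U·∇)V + ∇P′ = 0` for `V = ∂ₛU(·, s)`, `P′ = ∂ₛP(·, s)`
(`𝓡V = JV − (Jy·∇)V`); if `V ∈ C²` obeys `|V| ≤ D₀/(1+|y|)`, `|DV| ≤ D₁/(1+|y|²)`,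
`|D²V| ≤ D₂/(1+|y|³)` (the second display, `k ≤ 2`), the profile obeys (8.3) for `k ≤ 1`
(`|U| ≤ C₀/(1+|y|)`, `|DU| ≤ C₁/(1+|y|²)`), `|∇P′(y)| ≤ D_P/(1+|y|)` (the bound on `∇∂ₛP`), and
the equation holds with `W = ∂ₛV = ∂²ₛU(·, s)`, then
`|W(y)| ≤ (1+|α|)(D₀ + 2D₁ + 6D₂ + C₁D₀ + C₀D₁ + D_P)/(1+|y|)`. With the printed sizes
`Dₖ, D_P = O(C_{U,s}(1+|α|))` this is the `(1+|α|)²` of (8.2).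
[cite: PineauVicol2026, Lemma 8.1, proof (p. 28); (1.14a) (p. 7)] -/
theorem norm_sliceDeriv2_le_of_dslice_equation
    {U V W : EuclideanSpace ℝ (Fin 3) → EuclideanSpace ℝ (Fin 3)} {P' : EuclideanSpace ℝ (Fin 3) → ℝ}
    {α : ℝ} (hV : ContDiff ℝ 2 V) {C₀ C₁ D₀ D₁ D₂ DP : ℝ}
    (hU0 : ∀ y, ‖U y‖ ≤ C₀ / (1 + ‖y‖)) (hU1 : ∀ y, ‖fderiv ℝ U y‖ ≤ C₁ / (1 + ‖y‖ ^ 2))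
    (hV0 : ∀ y, ‖V y‖ ≤ D₀ / (1 + ‖y‖)) (hV1 : ∀ y, ‖fderiv ℝ V y‖ ≤ D₁ / (1 + ‖y‖ ^ 2))
    (hV2 : ∀ y, ‖fderiv ℝ (fderiv ℝ V) y‖ ≤ D₂ / (1 + ‖y‖ ^ 3))
    (hP : ∀ y, ‖gradient P' y‖ ≤ DP / (1 + ‖y‖))
    (heq : ∀ y, α • (rotGen (V y) - fderiv ℝ V y (rotGen y)) + (1 / 2 : ℝ) • V y +
      (1 / 2 : ℝ) • fderiv ℝ V y y - (Δ V) y + (convect V U y + convect U V y) + gradient P' y +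
        W y = 0)
    (y : EuclideanSpace ℝ (Fin 3)) :
    ‖W y‖ ≤ (1 + |α|) * (D₀ + 2 * D₁ + 6 * D₂ + C₁ * D₀ + C₀ * D₁ + DP) / (1 + ‖y‖) := by
  have hw : 0 < 1 + ‖y‖ := by positivity
  have ha : 0 ≤ |α| := abs_nonneg α
  have hC0 : 0 ≤ C₀ := by
    have h := (norm_nonneg _).trans (hU0 0); rw [norm_zero] at h; norm_num at h; exact h
  have hC1 : 0 ≤ C₁ := by
    have h := (norm_nonneg _).trans (hU1 0); rw [norm_zero] at h; norm_num at h; exact h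
  have hD0 : 0 ≤ D₀ := by
    have h := (norm_nonneg _).trans (hV0 0); rw [norm_zero] at h; norm_num at h; exact h
  have hD1 : 0 ≤ D₁ := by
    have h := (norm_nonneg _).trans (hV1 0); rw [norm_zero] at h; norm_num at h; exact h
  have hD2 : 0 ≤ D₂ := by
    have h2 := hV2 0
    rw [norm_zero] at h2; norm_num at h2
    have hL0 : ‖(Δ V) 0‖ ≤ 3 * D₂ :=
      (norm_laplacian_le_three_mul_aux' hV 0).trans (mul_le_mul_of_nonneg_left h2 (by norm_num))
    have h0 := norm_nonneg ((Δ V) 0)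
    linarith
  have hDP : 0 ≤ DP := by
    have h := (norm_nonneg _).trans (hP 0); rw [norm_zero] at h; norm_num at h; exact h
  have hT := one_add_norm_mul_norm_linearTerms_le (α := α) hV hV0 hV1 hV2 y
  have hPy : (1 + ‖y‖) * ‖gradient P' y‖ ≤ DP := by
    have h := hP y; rw [le_div_iff₀ hw] at h; linarith
  -- the two convective terms: `(1+|y|)|(V·∇)U| ≤ C₁D₀`, `(1+|y|)|(U·∇)V| ≤ C₀D₁`
  have bV : (1 + ‖y‖) * ‖V y‖ ≤ D₀ := by
    have h := hV0 y; rw [le_div_iff₀ hw] at h; linarith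
  have bU : (1 + ‖y‖) * ‖U y‖ ≤ C₀ := by
    have h := hU0 y; rw [le_div_iff₀ hw] at h; linarith
  have bDU : ‖fderiv ℝ U y‖ ≤ C₁ :=
    (hU1 y).trans (div_le_self hC1 (le_add_of_nonneg_right (by positivity)))
  have bDV : ‖fderiv ℝ V y‖ ≤ D₁ :=
    (hV1 y).trans (div_le_self hD1 (le_add_of_nonneg_right (by positivity)))
  have hc : (1 + ‖y‖) * ‖convect V U y + convect U V y‖ ≤ C₁ * D₀ + C₀ * D₁ := by
    rw [convect_apply, convect_apply]
    have h1 : ‖(fderiv ℝ U y) (V y)‖ ≤ ‖fderiv ℝ U y‖ * ‖V y‖ := ContinuousLinearMap.le_opNorm _ _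
    have h2 : ‖(fderiv ℝ V y) (U y)‖ ≤ ‖fderiv ℝ V y‖ * ‖U y‖ := ContinuousLinearMap.le_opNorm _ _
    calc (1 + ‖y‖) * ‖(fderiv ℝ U y) (V y) + (fderiv ℝ V y) (U y)‖
        ≤ (1 + ‖y‖) * (‖fderiv ℝ U y‖ * ‖V y‖ + ‖fderiv ℝ V y‖ * ‖U y‖) :=
          mul_le_mul_of_nonneg_left ((norm_add_le _ _).trans (add_le_add h1 h2)) hw.le
      _ = ‖fderiv ℝ U y‖ * ((1 + ‖y‖) * ‖V y‖) + ‖fderiv ℝ V y‖ * ((1 + ‖y‖) * ‖U y‖) := by ring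
      _ ≤ C₁ * D₀ + D₁ * C₀ :=
          add_le_add (mul_le_mul bDU bV (mul_nonneg hw.le (norm_nonneg _)) hC1)
            (mul_le_mul bDV bU (mul_nonneg hw.le (norm_nonneg _)) hD1)
      _ = C₁ * D₀ + C₀ * D₁ := by ring
  have hF : W y = -((α • (rotGen (V y) - fderiv ℝ V y (rotGen y)) + (1 / 2 : ℝ) • V y +
      (1 / 2 : ℝ) • fderiv ℝ V y y - (Δ V) y) + (convect V U y + convect U V y) + gradient P' y) := by
    rw [eq_neg_iff_add_eq_zero, ← heq y]; abel
  rw [le_div_iff₀ hw, hF, norm_neg, mul_comm]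
  have h3 : ‖(α • (rotGen (V y) - fderiv ℝ V y (rotGen y)) + (1 / 2 : ℝ) • V y +
      (1 / 2 : ℝ) • fderiv ℝ V y y - (Δ V) y) + (convect V U y + convect U V y) + gradient P' y‖ ≤
      ‖α • (rotGen (V y) - fderiv ℝ V y (rotGen y)) + (1 / 2 : ℝ) • V y +
        (1 / 2 : ℝ) • fderiv ℝ V y y - (Δ V) y‖ + ‖convect V U y + convect U V y‖ +
        ‖gradient P' y‖ := by
    have h₁ := norm_add_le ((α • (rotGen (V y) - fderiv ℝ V y (rotGen y)) + (1 / 2 : ℝ) • V y +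
      (1 / 2 : ℝ) • fderiv ℝ V y y - (Δ V) y) + (convect V U y + convect U V y)) (gradient P' y)
    have h₂ := norm_add_le (α • (rotGen (V y) - fderiv ℝ V y (rotGen y)) + (1 / 2 : ℝ) • V y +
      (1 / 2 : ℝ) • fderiv ℝ V y y - (Δ V) y) (convect V U y + convect U V y)
    linarith
  refine (mul_le_mul_of_nonneg_left h3 hw.le).trans ?_
  rw [mul_add, mul_add]
  nlinarith [mul_nonneg ha hD0, mul_nonneg ha hD1, mul_nonneg ha hD2, mul_nonneg ha hDP,
    mul_nonneg ha (mul_nonneg hC1 hD0), mul_nonneg ha (mul_nonneg hC0 hD1)]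

set_option maxHeartbeats 1600000 in
/-- **Pineau–Vicol 2026, Lemma 8.1, proof — `∂ₛ` applied to the equation (third display, `k = 1`).**
The GRADIENT of `∂²ₛU` read off the `y`-derivative of the `s`-differentiated equation (1.14a),
`∂ₛV + α𝓡V + ½V + ½(y·∇)V − ΔV + (V·∇)U + (U·∇)V + ∇P′ = 0` (`V = ∂ₛU(·,s)`, `P′ = ∂ₛP(·,s)`),
on one slice: if `V ∈ C³`, `U ∈ C²`, `P′ ∈ C²`, `V` obeys `|V| ≤ D₀/(1+|y|)`, `|DV| ≤ D₁/(1+|y|²)`,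
`|D²V| ≤ D₂/(1+|y|³)`, `|D(ΔV)| ≤ D₃/(1+|y|)²` (the second display, `k ≤ 3`), `U` obeys (8.3) for
`k ≤ 2` (`|U| ≤ C₀/(1+|y|)`, `|DU| ≤ C₁/(1+|y|²)`, `|D²U| ≤ C₂/(1+|y|³)`), `|D∇P′| ≤ D_P/(1+|y|)²`,
and the equation holds with `W = ∂ₛV = ∂²ₛU(·,s)`, then
`‖DW(y)‖ ≤ (1+|α|)(4D₁ + 3D₂ + D₃ + 4C₁D₁ + 2C₂D₀ + 2C₀D₂ + D_P)/(1+|y|)²`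
(`DW = −[α(J∘DV − DV∘J − D²V(·)(Jy)) + ½DV + ½(DV + D²V(·)(y)) − D(ΔV) + (DU∘DV + D²U(·)(V)) +
(DV∘DU + D²V(·)(U)) + D∇P′]`). With the printed sizes `Dₖ, D_P = O(C_{U,s}(1+|α|))` this is the
second half of the display `|∇∂²ₛU| ≤ C_{U,s}(1+|α|)²(1+|y|)⁻²`.
[cite: PineauVicol2026, Lemma 8.1, proof (p. 28); (1.14a) (p. 7)] -/
theorem norm_fderiv_sliceDeriv2_le_of_dslice_equation
    {U V W : EuclideanSpace ℝ (Fin 3) → EuclideanSpace ℝ (Fin 3)} {P' : EuclideanSpace ℝ (Fin 3) → ℝ}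
    {α : ℝ} (hV : ContDiff ℝ 3 V) (hU : ContDiff ℝ 2 U) (hP : ContDiff ℝ 2 P')
    {C₀ C₁ C₂ D₀ D₁ D₂ D₃ DP : ℝ}
    (hU0 : ∀ y, ‖U y‖ ≤ C₀ / (1 + ‖y‖)) (hU1 : ∀ y, ‖fderiv ℝ U y‖ ≤ C₁ / (1 + ‖y‖ ^ 2))
    (hU2 : ∀ y, ‖fderiv ℝ (fderiv ℝ U) y‖ ≤ C₂ / (1 + ‖y‖ ^ 3))
    (hV0 : ∀ y, ‖V y‖ ≤ D₀ / (1 + ‖y‖)) (hV1 : ∀ y, ‖fderiv ℝ V y‖ ≤ D₁ / (1 + ‖y‖ ^ 2))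
    (hV2 : ∀ y, ‖fderiv ℝ (fderiv ℝ V) y‖ ≤ D₂ / (1 + ‖y‖ ^ 3))
    (hV3 : ∀ y, ‖fderiv ℝ (Δ V) y‖ ≤ D₃ / (1 + ‖y‖) ^ 2)
    (hP2 : ∀ y, ‖fderiv ℝ (gradient P') y‖ ≤ DP / (1 + ‖y‖) ^ 2)
    (heq : ∀ y, α • (rotGen (V y) - fderiv ℝ V y (rotGen y)) + (1 / 2 : ℝ) • V y +
      (1 / 2 : ℝ) • fderiv ℝ V y y - (Δ V) y + (convect V U y + convect U V y) + gradient P' y +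
        W y = 0)
    (y : EuclideanSpace ℝ (Fin 3)) :
    ‖fderiv ℝ W y‖ ≤ (1 + |α|) *
      (4 * D₁ + 3 * D₂ + D₃ + 4 * C₁ * D₁ + 2 * C₂ * D₀ + 2 * C₀ * D₂ + DP) / (1 + ‖y‖) ^ 2 := by
  set r : ℝ := ‖y‖ with hr
  have hr0 : 0 ≤ r := norm_nonneg y
  have hw : 0 < 1 + r := by positivity
  have hw2 : 0 < (1 + r) ^ 2 := by positivity
  have ha : 0 ≤ |α| := abs_nonneg α
  have hC0 : 0 ≤ C₀ := by
    have h := (norm_nonneg _).trans (hU0 0); rw [norm_zero] at h; norm_num at h; exact h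
  have hC1 : 0 ≤ C₁ := by
    have h := (norm_nonneg _).trans (hU1 0); rw [norm_zero] at h; norm_num at h; exact h
  have hC2 : 0 ≤ C₂ := by
    have h := hU2 0
    rw [norm_zero] at h; norm_num at h
    have h0 : (0 : ℝ) ≤ ‖fderiv ℝ (fderiv ℝ U) (0 : EuclideanSpace ℝ (Fin 3))‖ := by positivity
    linarith
  have hD0 : 0 ≤ D₀ := by
    have h := (norm_nonneg _).trans (hV0 0); rw [norm_zero] at h; norm_num at h; exact h
  have hD1 : 0 ≤ D₁ := by
    have h := (norm_nonneg _).trans (hV1 0); rw [norm_zero] at h; norm_num at h; exact h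
  have hD2 : 0 ≤ D₂ := by
    have h := hV2 0
    rw [norm_zero] at h; norm_num at h
    have h0 : (0 : ℝ) ≤ ‖fderiv ℝ (fderiv ℝ V) (0 : EuclideanSpace ℝ (Fin 3))‖ := by positivity
    linarith
  have hD3 : 0 ≤ D₃ := by
    have h := (norm_nonneg _).trans (hV3 0); rw [norm_zero] at h; norm_num at h; exact h
  have hDP : 0 ≤ DP := by
    have h := (norm_nonneg _).trans (hP2 0); rw [norm_zero] at h; norm_num at h; exact h
  -- differentiability
  have hVd : Differentiable ℝ V := hV.differentiable (by norm_num)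
  have hDV : ContDiff ℝ 2 (fderiv ℝ V) := hV.fderiv_right (m := 2) (by norm_num)
  have hDVd : Differentiable ℝ (fderiv ℝ V) := hDV.differentiable (by norm_num)
  have hUd : Differentiable ℝ U := hU.differentiable (by norm_num)
  have hDUd : Differentiable ℝ (fderiv ℝ U) :=
    (hU.fderiv_right (m := 1) (by norm_num)).differentiable one_ne_zero
  have hΔd : Differentiable ℝ (Δ V) :=
    (contDiff_laplacian (n := 1) (by exact_mod_cast hV)).differentiable one_ne_zero
  have hgP : Differentiable ℝ (gradient P') := by
    have h1 : ContDiff ℝ 1 (fderiv ℝ P') := hP.fderiv_right (m := 1) (by norm_num)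
    have h2 : gradient P' = fun x => (InnerProductSpace.toDual ℝ (EuclideanSpace ℝ (Fin 3))).symm
        (fderiv ℝ P' x) := rfl
    rw [h2]
    exact (InnerProductSpace.toDual ℝ (EuclideanSpace ℝ (Fin 3))).symm.differentiable.comp
      (h1.differentiable one_ne_zero)
  -- `W` as a function
  have hF : W = fun y => -(α • (rotGenL (V y) - fderiv ℝ V y (rotGenL y)) + (1 / 2 : ℝ) • V y +
      (1 / 2 : ℝ) • fderiv ℝ V y y - (Δ V) y + ((fderiv ℝ U y) (V y) + (fderiv ℝ V y) (U y)) +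
      gradient P' y) := by
    funext z
    have hz := heq z
    rw [convect_apply, convect_apply] at hz
    rw [eq_neg_iff_add_eq_zero, rotGenL_apply, rotGenL_apply, ← hz]
    abel
  -- derivatives of the pieces at `y`
  have dJV : HasFDerivAt (fun z => rotGenL (V z)) (rotGenL.comp (fderiv ℝ V y)) y :=
    rotGenL.hasFDerivAt.comp y (hVd y).hasFDerivAt
  have dDVJ : HasFDerivAt (fun z => fderiv ℝ V z (rotGenL z))
      ((fderiv ℝ V y).comp rotGenL + (fderiv ℝ (fderiv ℝ V) y).flip (rotGenL y)) y :=
    (hDVd y).hasFDerivAt.clm_apply rotGenL.hasFDerivAt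
  have dDVy : HasFDerivAt (fun z => fderiv ℝ V z z)
      ((fderiv ℝ V y).comp (ContinuousLinearMap.id ℝ _) + (fderiv ℝ (fderiv ℝ V) y).flip y) y :=
    (hDVd y).hasFDerivAt.clm_apply (hasFDerivAt_id y)
  have dconv1 : HasFDerivAt (fun z => (fderiv ℝ U z) (V z))
      ((fderiv ℝ U y).comp (fderiv ℝ V y) + (fderiv ℝ (fderiv ℝ U) y).flip (V y)) y :=
    (hDUd y).hasFDerivAt.clm_apply (hVd y).hasFDerivAt
  have dconv2 : HasFDerivAt (fun z => (fderiv ℝ V z) (U z))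
      ((fderiv ℝ V y).comp (fderiv ℝ U y) + (fderiv ℝ (fderiv ℝ V) y).flip (U y)) y :=
    (hDVd y).hasFDerivAt.clm_apply (hUd y).hasFDerivAt
  have dall : HasFDerivAt W (-(α • (rotGenL.comp (fderiv ℝ V y) -
      ((fderiv ℝ V y).comp rotGenL + (fderiv ℝ (fderiv ℝ V) y).flip (rotGenL y))) +
      (1 / 2 : ℝ) • fderiv ℝ V y +
      (1 / 2 : ℝ) • ((fderiv ℝ V y).comp (ContinuousLinearMap.id ℝ _) + (fderiv ℝ (fderiv ℝ V) y).flip y) -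
      fderiv ℝ (Δ V) y +
      (((fderiv ℝ U y).comp (fderiv ℝ V y) + (fderiv ℝ (fderiv ℝ U) y).flip (V y)) +
        ((fderiv ℝ V y).comp (fderiv ℝ U y) + (fderiv ℝ (fderiv ℝ V) y).flip (U y))) +
      fderiv ℝ (gradient P') y)) y := by
    rw [hF]
    exact ((((((dJV.sub dDVJ).const_smul α).add ((hVd y).hasFDerivAt.const_smul (1 / 2 : ℝ))).add
      (dDVy.const_smul (1 / 2 : ℝ))).sub (hΔd y).hasFDerivAt).add (dconv1.add dconv2) |>.add
      (hgP y).hasFDerivAt).neg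
  rw [dall.fderiv, norm_neg]
  -- weighted bounds on the building blocks
  have nJ : ‖rotGenL‖ ≤ 1 := norm_rotGenL_le_one'
  have nJy : ‖rotGenL y‖ ≤ r := by rw [rotGenL_apply, hr]; exact norm_rotGen_le y
  have b1 : (1 + r) ^ 2 * ‖fderiv ℝ V y‖ ≤ 2 * D₁ := by
    have h := hV1 y; rw [← hr] at h
    have h2 : 0 < 1 + r ^ 2 := by positivity
    have h3 : ‖fderiv ℝ V y‖ * (1 + r ^ 2) ≤ D₁ := by rwa [le_div_iff₀ h2] at h
    have h4 : (1 + r) ^ 2 ≤ 2 * (1 + r ^ 2) := by nlinarith [sq_nonneg (r - 1)]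
    have hn : 0 ≤ ‖fderiv ℝ V y‖ := norm_nonneg _
    nlinarith
  have b2 : (1 + r) ^ 2 * (‖fderiv ℝ (fderiv ℝ V) y‖ * r) ≤ 3 * D₂ := by
    have h := hV2 y; rw [← hr] at h
    have h2 : 0 < 1 + r ^ 3 := by positivity
    have h3 : ‖fderiv ℝ (fderiv ℝ V) y‖ * (1 + r ^ 3) ≤ D₂ := by rwa [le_div_iff₀ h2] at h
    have h4 : (1 + r) ^ 2 * r ≤ 3 * (1 + r ^ 3) := by
      nlinarith [sq_nonneg (r - 1), mul_nonneg hr0 (sq_nonneg (r - 1)), sq_nonneg r]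
    have hn : 0 ≤ ‖fderiv ℝ (fderiv ℝ V) y‖ := by positivity
    calc (1 + r) ^ 2 * (‖fderiv ℝ (fderiv ℝ V) y‖ * r)
        = ‖fderiv ℝ (fderiv ℝ V) y‖ * ((1 + r) ^ 2 * r) := by ring
      _ ≤ ‖fderiv ℝ (fderiv ℝ V) y‖ * (3 * (1 + r ^ 3)) := mul_le_mul_of_nonneg_left h4 hn
      _ = 3 * (‖fderiv ℝ (fderiv ℝ V) y‖ * (1 + r ^ 3)) := by ring
      _ ≤ 3 * D₂ := by linarith
  -- `(1+r)² ‖D²A‖ |B| ≤ 2 K_A K_B` for the two cross terms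
  have cross : ∀ {A B : EuclideanSpace ℝ (Fin 3) → EuclideanSpace ℝ (Fin 3)} {KA KB : ℝ},
      (‖fderiv ℝ (fderiv ℝ A) y‖ ≤ KA / (1 + ‖y‖ ^ 3)) → (‖B y‖ ≤ KB / (1 + ‖y‖)) →
      (1 + r) ^ 2 * (‖fderiv ℝ (fderiv ℝ A) y‖ * ‖B y‖) ≤ 2 * KA * KB := by
    intro A B KA KB hA hB
    rw [← hr] at hA hB
    have h2 : 0 < 1 + r ^ 3 := by positivity
    have h3 : ‖fderiv ℝ (fderiv ℝ A) y‖ * (1 + r ^ 3) ≤ KA := by rwa [le_div_iff₀ h2] at hA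
    have h5 : ‖B y‖ * (1 + r) ≤ KB := by rwa [le_div_iff₀ hw] at hB
    have h4 : (1 + r) ≤ 2 * (1 + r ^ 3) := by
      nlinarith [mul_nonneg hr0 (sq_nonneg (r - 1)), sq_nonneg (2 * r - 1)]
    have hn : 0 ≤ ‖fderiv ℝ (fderiv ℝ A) y‖ := by positivity
    have hKA : 0 ≤ KA := le_trans (by positivity) h3
    calc (1 + r) ^ 2 * (‖fderiv ℝ (fderiv ℝ A) y‖ * ‖B y‖)
        = (‖fderiv ℝ (fderiv ℝ A) y‖ * (1 + r)) * (‖B y‖ * (1 + r)) := by ring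
      _ ≤ (‖fderiv ℝ (fderiv ℝ A) y‖ * (2 * (1 + r ^ 3))) * KB :=
          mul_le_mul (mul_le_mul_of_nonneg_left h4 hn) h5 (by positivity) (by positivity)
      _ = 2 * KB * (‖fderiv ℝ (fderiv ℝ A) y‖ * (1 + r ^ 3)) := by ring
      _ ≤ 2 * KB * KA := by
          have hKB : 0 ≤ KB := le_trans (by positivity) h5
          exact mul_le_mul_of_nonneg_left h3 (by positivity)
      _ = 2 * KA * KB := by ring
  have b6 : (1 + r) ^ 2 * (‖fderiv ℝ (fderiv ℝ U) y‖ * ‖V y‖) ≤ 2 * C₂ * D₀ := cross (hU2 y) (hV0 y)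
  have b8 : (1 + r) ^ 2 * (‖fderiv ℝ (fderiv ℝ V) y‖ * ‖U y‖) ≤ 2 * D₂ * C₀ := cross (hV2 y) (hU0 y)
  have b5 : (1 + r) ^ 2 * (‖fderiv ℝ U y‖ * ‖fderiv ℝ V y‖) ≤ 2 * C₁ * D₁ := by
    have hD : ‖fderiv ℝ U y‖ ≤ C₁ :=
      (hU1 y).trans (div_le_self hC1 (le_add_of_nonneg_right (by positivity)))
    have hn : 0 ≤ ‖fderiv ℝ V y‖ := norm_nonneg _
    calc (1 + r) ^ 2 * (‖fderiv ℝ U y‖ * ‖fderiv ℝ V y‖)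
        = ‖fderiv ℝ U y‖ * ((1 + r) ^ 2 * ‖fderiv ℝ V y‖) := by ring
      _ ≤ C₁ * (2 * D₁) := mul_le_mul hD b1 (by positivity) hC1
      _ = 2 * C₁ * D₁ := by ring
  have b3 : (1 + r) ^ 2 * ‖fderiv ℝ (Δ V) y‖ ≤ D₃ := by
    have h := hV3 y; rw [← hr, le_div_iff₀ hw2] at h; linarith
  have b4 : (1 + r) ^ 2 * ‖fderiv ℝ (gradient P') y‖ ≤ DP := by
    have h := hP2 y; rw [← hr, le_div_iff₀ hw2] at h; linarith
  -- operator-norm bounds of the composite pieces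
  have n1 : ‖rotGenL.comp (fderiv ℝ V y)‖ ≤ ‖fderiv ℝ V y‖ :=
    (ContinuousLinearMap.opNorm_comp_le _ _).trans (mul_le_of_le_one_left (norm_nonneg _) nJ)
  have n2 : ‖(fderiv ℝ V y).comp rotGenL + (fderiv ℝ (fderiv ℝ V) y).flip (rotGenL y)‖ ≤
      ‖fderiv ℝ V y‖ + ‖fderiv ℝ (fderiv ℝ V) y‖ * r := by
    refine (norm_add_le _ _).trans (add_le_add ?_ ?_)
    · exact (ContinuousLinearMap.opNorm_comp_le _ _).trans (mul_le_of_le_one_right (norm_nonneg _) nJ)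
    · refine (ContinuousLinearMap.le_opNorm _ _).trans ?_
      rw [ContinuousLinearMap.opNorm_flip]
      exact mul_le_mul_of_nonneg_left nJy (by positivity)
  have n3 : ‖(fderiv ℝ V y).comp (ContinuousLinearMap.id ℝ _) + (fderiv ℝ (fderiv ℝ V) y).flip y‖ ≤
      ‖fderiv ℝ V y‖ + ‖fderiv ℝ (fderiv ℝ V) y‖ * r := by
    refine (norm_add_le _ _).trans (add_le_add ?_ ?_)
    · rw [ContinuousLinearMap.comp_id]
    · refine (ContinuousLinearMap.le_opNorm _ _).trans ?_
      rw [ContinuousLinearMap.opNorm_flip, hr]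
  have n4 : ‖((fderiv ℝ U y).comp (fderiv ℝ V y) + (fderiv ℝ (fderiv ℝ U) y).flip (V y)) +
        ((fderiv ℝ V y).comp (fderiv ℝ U y) + (fderiv ℝ (fderiv ℝ V) y).flip (U y))‖ ≤
      (‖fderiv ℝ U y‖ * ‖fderiv ℝ V y‖ + ‖fderiv ℝ (fderiv ℝ U) y‖ * ‖V y‖) +
      (‖fderiv ℝ V y‖ * ‖fderiv ℝ U y‖ + ‖fderiv ℝ (fderiv ℝ V) y‖ * ‖U y‖) := by
    refine (norm_add_le _ _).trans (add_le_add ?_ ?_)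
    · refine (norm_add_le _ _).trans (add_le_add (ContinuousLinearMap.opNorm_comp_le _ _) ?_)
      refine (ContinuousLinearMap.le_opNorm _ _).trans ?_
      rw [ContinuousLinearMap.opNorm_flip]
    · refine (norm_add_le _ _).trans (add_le_add (ContinuousLinearMap.opNorm_comp_le _ _) ?_)
      refine (ContinuousLinearMap.le_opNorm _ _).trans ?_
      rw [ContinuousLinearMap.opNorm_flip]
  -- assemble
  have hsum : ∀ a b c d e f : EuclideanSpace ℝ (Fin 3) →L[ℝ] EuclideanSpace ℝ (Fin 3),
      ‖a + b + c - d + e + f‖ ≤ ‖a‖ + ‖b‖ + ‖c‖ + ‖d‖ + ‖e‖ + ‖f‖ := by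
    intro a b c d e f
    have h₀ := norm_add_le (a + b + c - d + e) f
    have h₁ := norm_add_le (a + b + c - d) e
    have h₂ := norm_sub_le (a + b + c) d
    have h₃ := norm_add_le (a + b) c
    have h₄ := norm_add_le a b
    linarith
  have na : ‖α • (rotGenL.comp (fderiv ℝ V y) -
      ((fderiv ℝ V y).comp rotGenL + (fderiv ℝ (fderiv ℝ V) y).flip (rotGenL y)))‖ ≤
      |α| * (2 * ‖fderiv ℝ V y‖ + ‖fderiv ℝ (fderiv ℝ V) y‖ * r) := by
    rw [norm_smul, Real.norm_eq_abs]
    refine mul_le_mul_of_nonneg_left ((norm_sub_le _ _).trans ?_) ha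
    linarith
  have nb : ‖(1 / 2 : ℝ) • fderiv ℝ V y‖ ≤ 1 / 2 * ‖fderiv ℝ V y‖ := by
    rw [norm_smul, Real.norm_of_nonneg (by norm_num : (0 : ℝ) ≤ 1 / 2)]
  have nc : ‖(1 / 2 : ℝ) • ((fderiv ℝ V y).comp (ContinuousLinearMap.id ℝ _) +
      (fderiv ℝ (fderiv ℝ V) y).flip y)‖ ≤ 1 / 2 * (‖fderiv ℝ V y‖ + ‖fderiv ℝ (fderiv ℝ V) y‖ * r) := by
    rw [norm_smul, Real.norm_of_nonneg (by norm_num : (0 : ℝ) ≤ 1 / 2)]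
    exact mul_le_mul_of_nonneg_left n3 (by norm_num)
  have htot := hsum (α • (rotGenL.comp (fderiv ℝ V y) -
      ((fderiv ℝ V y).comp rotGenL + (fderiv ℝ (fderiv ℝ V) y).flip (rotGenL y))))
      ((1 / 2 : ℝ) • fderiv ℝ V y)
      ((1 / 2 : ℝ) • ((fderiv ℝ V y).comp (ContinuousLinearMap.id ℝ _) + (fderiv ℝ (fderiv ℝ V) y).flip y))
      (fderiv ℝ (Δ V) y)
      (((fderiv ℝ U y).comp (fderiv ℝ V y) + (fderiv ℝ (fderiv ℝ U) y).flip (V y)) +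
        ((fderiv ℝ V y).comp (fderiv ℝ U y) + (fderiv ℝ (fderiv ℝ V) y).flip (U y)))
      (fderiv ℝ (gradient P') y)
  -- stage 1: operator norms
  set a : ℝ := ‖fderiv ℝ V y‖ with ha_def
  set b : ℝ := ‖fderiv ℝ (fderiv ℝ V) y‖ * r with hb_def
  set c : ℝ := ‖fderiv ℝ (Δ V) y‖ with hc_def
  set d₁ : ℝ := ‖fderiv ℝ U y‖ * ‖fderiv ℝ V y‖ with hd1_def
  set d₂ : ℝ := ‖fderiv ℝ (fderiv ℝ U) y‖ * ‖V y‖ with hd2_def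
  set d₃ : ℝ := ‖fderiv ℝ (fderiv ℝ V) y‖ * ‖U y‖ with hd3_def
  set e : ℝ := ‖fderiv ℝ (gradient P') y‖ with he_def
  have hd1' : ‖fderiv ℝ V y‖ * ‖fderiv ℝ U y‖ = d₁ := by rw [hd1_def, mul_comm]
  have stage1 : ‖α • (rotGenL.comp (fderiv ℝ V y) -
      ((fderiv ℝ V y).comp rotGenL + (fderiv ℝ (fderiv ℝ V) y).flip (rotGenL y))) +
      (1 / 2 : ℝ) • fderiv ℝ V y +
      (1 / 2 : ℝ) • ((fderiv ℝ V y).comp (ContinuousLinearMap.id ℝ _) + (fderiv ℝ (fderiv ℝ V) y).flip y) -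
      fderiv ℝ (Δ V) y +
      (((fderiv ℝ U y).comp (fderiv ℝ V y) + (fderiv ℝ (fderiv ℝ U) y).flip (V y)) +
        ((fderiv ℝ V y).comp (fderiv ℝ U y) + (fderiv ℝ (fderiv ℝ V) y).flip (U y))) +
      fderiv ℝ (gradient P') y‖ ≤
      |α| * (2 * a + b) + 1 / 2 * a + 1 / 2 * (a + b) + c + ((d₁ + d₂) + (d₁ + d₃)) + e := by
    rw [hd1'] at n4
    linarith [na, nb, nc, n4, htot]
  -- stage 2: weights
  have w2a : (1 + r) ^ 2 * a ≤ 2 * D₁ := b1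
  have w2b : (1 + r) ^ 2 * b ≤ 3 * D₂ := b2
  have w2c : (1 + r) ^ 2 * c ≤ D₃ := b3
  have w2d1 : (1 + r) ^ 2 * d₁ ≤ 2 * C₁ * D₁ := b5
  have w2d2 : (1 + r) ^ 2 * d₂ ≤ 2 * C₂ * D₀ := b6
  have w2d3 : (1 + r) ^ 2 * d₃ ≤ 2 * D₂ * C₀ := b8
  have w2e : (1 + r) ^ 2 * e ≤ DP := b4
  have key : (1 + r) ^ 2 * (|α| * (2 * a + b) + 1 / 2 * a + 1 / 2 * (a + b) + c +
      ((d₁ + d₂) + (d₁ + d₃)) + e) =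
      |α| * (2 * ((1 + r) ^ 2 * a) + (1 + r) ^ 2 * b) + 1 / 2 * ((1 + r) ^ 2 * a) +
      1 / 2 * ((1 + r) ^ 2 * a + (1 + r) ^ 2 * b) + (1 + r) ^ 2 * c +
      (((1 + r) ^ 2 * d₁ + (1 + r) ^ 2 * d₂) + ((1 + r) ^ 2 * d₁ + (1 + r) ^ 2 * d₃)) +
      (1 + r) ^ 2 * e := by ring
  have t1 : |α| * (2 * ((1 + r) ^ 2 * a) + (1 + r) ^ 2 * b) ≤ |α| * (4 * D₁ + 3 * D₂) :=
    mul_le_mul_of_nonneg_left (by linarith) ha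
  rw [le_div_iff₀ hw2, mul_comm]
  calc (1 + r) ^ 2 * ‖α • (rotGenL.comp (fderiv ℝ V y) -
      ((fderiv ℝ V y).comp rotGenL + (fderiv ℝ (fderiv ℝ V) y).flip (rotGenL y))) +
      (1 / 2 : ℝ) • fderiv ℝ V y +
      (1 / 2 : ℝ) • ((fderiv ℝ V y).comp (ContinuousLinearMap.id ℝ _) + (fderiv ℝ (fderiv ℝ V) y).flip y) -
      fderiv ℝ (Δ V) y +
      (((fderiv ℝ U y).comp (fderiv ℝ V y) + (fderiv ℝ (fderiv ℝ U) y).flip (V y)) +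
        ((fderiv ℝ V y).comp (fderiv ℝ U y) + (fderiv ℝ (fderiv ℝ V) y).flip (U y))) +
      fderiv ℝ (gradient P') y‖
      ≤ (1 + r) ^ 2 * (|α| * (2 * a + b) + 1 / 2 * a + 1 / 2 * (a + b) + c +
          ((d₁ + d₂) + (d₁ + d₃)) + e) :=
        mul_le_mul_of_nonneg_left stage1 hw2.le
    _ = _ := key
    _ ≤ |α| * (4 * D₁ + 3 * D₂) + D₁ + (2 * D₁ + 3 * D₂) / 2 + D₃ +
        ((2 * C₁ * D₁ + 2 * C₂ * D₀) + (2 * C₁ * D₁ + 2 * D₂ * C₀)) + DP := by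
        linarith
    _ ≤ (1 + |α|) * (4 * D₁ + 3 * D₂ + D₃ + 4 * C₁ * D₁ + 2 * C₂ * D₀ + 2 * C₀ * D₂ + DP) := by
        nlinarith [mul_nonneg ha hD3, mul_nonneg ha hDP, mul_nonneg ha (mul_nonneg hC1 hD1),
          mul_nonneg ha (mul_nonneg hC2 hD0), mul_nonneg ha (mul_nonneg hC0 hD2), mul_nonneg hC1 hD1,
          mul_nonneg hC2 hD0, mul_nonneg hC0 hD2]

end PineauVicol2026

end Literature.Analysis.FluidPDE
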